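import Literature.AlgebraicGeometry.HodgeTheory.DivisorLefschetzGroup
import Literature.AlgebraicGeometry.HodgeTheory.HodgeRiemannDegreeOneAllDimensions
import Literature.AlgebraicGeometry.Deligne1982.SplitWeilTypeCMPeriodTransport
import Literature.AlgebraicGeometry.Milne1999.LefschetzCentraliserRosatiInvolution
import Literature.AlgebraicGeometry.Milne1999.SpecialLefschetzGroupOneEqUnitaryCentralizer
import Literature.Geometry.Kaehler.ComplexTorusVerySimpleFixedPointsEigenvalues
import Mathlib.Analysis.InnerProductSpace.Spectrum
import Mathlib.Analysis.InnerProductSpace.Adjoint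
import Mathlib.Analysis.InnerProductSpace.Projection.FiniteDimensional
import Mathlib.RingTheory.SimpleModule.Basic
import Mathlib.LinearAlgebra.Eigenspace.Minpoly
import HarnessLib

/-!
# Moonen–Zarhin's Lemma (3) «`End(V_X)^{G_div(X)} = B`» and Lemma (1) «`Z(G_div(X)) = U_{K_B}`», `⊗ ℂ`,
# for EVERY complex abelian variety of dimension `≥ 2` and every polarization class (PROVED)
# (rider, generation 17: and of dimension `1` — the primed statements hold for EVERY complex abelian variety of positive dimension)

Layer `Literature/AlgebraicGeometry/HodgeTheory`; THEOREMS ONLY — no definition, no named fact, sorry-free (D-0026,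
net debt 0). Sequel of the seat's `HodgeTheory/DivisorLefschetzGroup` (g13-#6: `symmetricPullbackSpan A h = S_λ ⊗ ℂ`,
`divisorLefschetzGroup A h = G_div(X)(h)(ℂ)`, and the inclusions `B ⊗ ℂ ⊆ End(V)^{G_div(X)(ℂ)}`,
`U_{K_B} ⊆ Z(G_div(X)(ℂ))`) and of `HodgeTheory/DivisorLefschetzGroupIsogeny` Chapter II (g15-#4: the two equalities
UNDER the hypothesis `hB : B ⊗ ℂ = End⁰(X) ⊗ ℂ`). Here the hypothesis `hB` is REMOVED: the equalities hold for every
complex abelian variety `A` with `2 ≤ dim A` and every class `h` which is rational with a Kähler multiple `s · h`,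
`s ≠ 0` — the lane's spelling of a polarization class (`Milne1999/SpecialLefschetzGroupOneEqUnitaryCentralizer`).

## The print

B. J. J. Moonen, Yu. G. Zarhin, *Weil classes on abelian varieties*, J. reine angew. Math. **496** (1998) =
arXiv:alg-geom/9612017 [MoonenZarhin1998WeilClasses], §1 (held text `paper:arxiv-alg-geom_9612017`), VERBATIM:
chunk p0002 L54–L58 «Choose a polarization `λ` of `X`, and write `α ↦ α†` for the associated Rosati involution of
`End⁰(X) ≅ M_m(D)`. Let `S_λ ⊆ End⁰(X)` be the set of `†`-symmetric elements. We define the algebra `B ⊆ End⁰(X)` as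
the `ℚ`-subalgebra generated by `S_λ`.»; L67–L71 «We define the algebraic group `G_div(X) ⊆ SP(V, φ)` as the
centralizer of `B` in `SP(V, φ)`. More precisely, `G_div(X) := Gl_B(V) ∩ SP(V, φ)`.»; L121–L124 «Lemma. (1) The center
of `G_div(X)` is the group `U_{K_B}` given by `U_{K_B}(R) = {a ∈ (K_B ⊗_ℚ R)^* ∣ a a† = 1}`.»; chunk p0003 L5–L6
«(3) `End(V_X)^{G_div(X)} = B`; `(⋀² V_X)^{G_div(X)} = 𝓑¹(X)`, and `(⊕ᵢ ⋀ⁱ V_X)^{G_div(X)} = 𝒟^•(X)`.»; L8–L12 «Proof.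
To prove this, we can first extend scalars to `ℂ`, and (1) and (2) then readily follow from Table 2. The last
statement is based on results from classical invariant theory; both the statement and its proof are in fact easy
variants of [Kum1] (see also [Haz1]).»

## The carrier (as in the seat's `DivisorLefschetzGroup`)

`V ⊗ ℂ = H¹(A(ℂ); ℂ) = complexBetti A.X 1`; `End⁰(X) ⊗ ℂ` = the `ℂ`-span of the pull-backs `φ^*`
(`VanGeemen1994.pullbackOne`); `φ ⊗ ℂ ∝ Q_h(x, y) = h^{dim A - 1} ⌣ x ⌣ y` (`Motives.polarizationPairingOne`), the Rosati
involution = the `Q_h`-adjoint; `S_λ ⊗ ℂ = symmetricPullbackSpan A h`; `B ⊗ ℂ = Algebra.adjoin ℂ (S_λ ⊗ ℂ)`;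
`G_div(X)(h)(ℂ) = divisorLefschetzGroup A h` (automorphisms commuting with `S_λ ⊗ ℂ` and preserving `Q_h`); the
commutant `C(S_λ ⊗ ℂ) = Subalgebra.centralizer ℂ (S_λ ⊗ ℂ)` (the ambient algebra `End_B(V) ⊗ ℂ` of `Gl_B(V)`); the Weil
operator `C = weilOperatorOne` (`i` on `H^{1,0}`, `-i` on `H^{0,1}`; `HodgeTheory/WeilOperatorDegreeOne`) and the
complex conjugation `σ = conjClass` of `H¹(A(ℂ); ℂ) = H¹(A(ℂ); ℝ) ⊗ ℂ` (`HodgeTheory/ComplexConjugation`).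

## What is proved (hypotheses: `2 ≤ dim A`, `h` rational, `s · h` Kähler for a real `s ≠ 0`)

(Rider, generation 17: each theorem below with the hypothesis `2 ≤ dim A` now has a PRIMED twin `…'` with `0 < dim A`
— every complex abelian variety of positive dimension, elliptic curves included — proved by the same road, the
positivity input being Hodge–Riemann in degree one IN EVERY DIMENSION
(`HodgeTheory/HodgeRiemannDegreeOneAllDimensions`: `exists_pos_polarizationPairingOne_weilOperatorOne_of_isKaehlerClass_smul'`,
here `DivisorLefschetzGroup.exists_pos_of_eq'`); the unprimed statements are kept and derived from the primed ones.)

* **`forall_mem_divisorLefschetzGroup_comm_iff_mem_adjoin_of_isKaehlerClass`** — LEMMA (3), FIRST CLAUSE, `⊗ ℂ`: an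
  endomorphism `T` of `H¹(A(ℂ); ℂ)` commutes with every element of `G_div(X)(h)(ℂ)` iff `T ∈ B ⊗ ℂ`; as an equality of
  sets `setOf_forall_mem_divisorLefschetzGroup_comm_eq_adjoin_of_isKaehlerClass`.
* **`mem_center_divisorLefschetzGroup_iff_coe_mem_adjoin_of_isKaehlerClass`**,
  **`mem_divisorLefschetzGroup_and_forall_comm_iff_of_isKaehlerClass`** — LEMMA (1) on `ℂ`-points: `z ∈ G_div(X)(h)(ℂ)` is
  central iff `z ∈ B ⊗ ℂ`; the centre is `{U ∈ Z(B ⊗ ℂ) = K_B ⊗ ℂ ∣ Q_h(Ux, Uy) = Q_h(x, y)}` («`a a† = 1`»).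
* **`adjoin_divisorLefschetzGroup_eq_centralizer`** — the `ℂ`-subalgebra of `End(H¹(A(ℂ); ℂ))` generated by `G_div(X)(ℂ)`
  IS the whole commutant `C(S_λ ⊗ ℂ) = End_{B ⊗ ℂ}(V ⊗ ℂ)` (the carrier form of «`G_div(X) ⊗ ℂ` is big in `Gl_B(V) ⊗ ℂ`»).
* **`isSemisimpleModule_adjoin_symmetricPullbackSpan`**, **`centralizer_centralizer_adjoin_symmetricPullbackSpan`** —
  `H¹(A(ℂ); ℂ)` is a semisimple `B ⊗ ℂ`-module and `B ⊗ ℂ` is its own bicommutant (the print's «`B` semisimple», Table 1).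
* **`divisorLefschetzGroup_eq_unitaryCentralizerGroup_iff_forall_mem_adjoin`** — `G_div(X)(h)(ℂ) = S(A)(h)(ℂ)` (Milne's group,
  the centralizer of all of `End⁰(X) ⊗ ℂ` in `Sp(Q_h)`) IFF `B ⊗ ℂ ∋` every pull-back, i.e. iff `B ⊗ ℂ = End⁰(X) ⊗ ℂ` (the
  converse of g13-#6's `divisorLefschetzGroup_eq_unitaryCentralizerGroup_of_forall_mem_adjoin`).

## The road (NOT the print's; classification-free)

The print reads Lemma (3) off Table 2 (the factors `G_div^{(τ)} = Sp`, `O`, `GL`, `U` by Albert type) and classical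
invariant theory. Here:
1. `G_div(X)(ℂ)` is the `Q_h`-unitary group of the commutant `C = C(S_λ ⊗ ℂ)` (which is stable under `†`, under `σ`,
   and contains the Weil operator `C`), and **the `ℂ`-span of `G_div(X)(ℂ)` is all of `C`**
   (`DivisorLefschetzGroup.centralizer_symmetricPullbackSpan_le_adjoin_divisorLefschetzGroup`): every `c ∈ C` is
   `c₁ + i c₂` with `cⱼ ∈ C` fixed by `θ(c) = C c̄ C⁻¹`; a `θ`-fixed `d` is `½(d + d†) + ½(d - d†)`;
   * a `Q_h`-SKEW `k ∈ C` lies in the span by the CAYLEY TRANSFORM (`…mem_adjoin_divisorLefschetzGroup_of_skew`): for `t ≠ 0`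
     off the inverses of the eigenvalues of `±k`, `u_t = (1 + tk)(1 - tk)⁻¹ ∈ G_div(X)(ℂ)` and `(1 - tk)⁻¹ = ½(1 + u_t)`, and
     finite-dimensional subalgebras are inverse-closed (`…val_inv_mem_of_mem`);
   * a `Q_h`-SYMMETRIC `θ`-fixed `a ∈ C` is self-adjoint for the POSITIVE-DEFINITE hermitian form
     `⟪x, y⟫ = ℓ(Q_h(y, C x̄))` (`…exists_innerProductSpaceCore`; positivity = Hodge–Riemann in degree one, the tree's
     `Deligne1982.exists_pos_polarizationPairingOne_weilOperatorOne_of_isKaehlerClass_smul`, plus `Q_h` alternating and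
     `Q_h(Cx, Cy) = Q_h(x, y)`), hence `a = ∑ μ P_μ` with spectral projections `P_μ ∈ C`, `Q_h`-symmetric (Mathlib's
     `LinearMap.IsSymmetric` spectral theory), and `1 - 2P_μ ∈ G_div(X)(ℂ)` (`…mem_adjoin_divisorLefschetzGroup_of_symm`).
2. So the commutant of `G_div(X)(ℂ)` is the bicommutant of `B ⊗ ℂ`; `B ⊗ ℂ` is closed under `⟪·, ·⟫`-adjoints (the
   adjoint of `b` is `\overline{b†}`), so `H¹` is a semisimple `B ⊗ ℂ`-module (orthogonal complements) and the DOUBLE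
   COMMUTANT THEOREM (the tree's `LinearAlgebra.Matrix.centralizer_centralizer_eq_of_isSemisimpleModule`, Bourbaki A VIII §5
   n°4) gives `(B ⊗ ℂ)'' = B ⊗ ℂ`.

NOT here: ~~curves~~ (`dim A = 1` — SETTLED by the generation-17 rider: the primed statements, via
`HodgeRiemannDegreeOneAllDimensions`),
`G_div` as an algebraic group over `ℚ` (connectedness, `π₀`, the torus rank `e₀` of Lemma (1)), Lemma (2), the other
clauses of Lemma (3) (the seat's `DivisorLefschetzGroupLargest`), Tables 1–2, anything about the Hodge conjecture.

## References

* [MoonenZarhin1998WeilClasses] B. J. J. Moonen, Yu. G. Zarhin, *Weil classes on abelian varieties*, J. reine angew.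
  Math. 496 (1998) = arXiv:alg-geom/9612017, §1: definition of `S_λ`, `B`, `G_div(X)` (chunk p0002 L54–L71), Lemma (1)
  (L121–L124), Lemma (3) and its proof (chunk p0003 L5–L12).
* [Deligne1982HodgeCycles] P. Deligne (notes by J. S. Milne), *Hodge cycles on abelian varieties*, LNM 900 (1982), §1
  (p. 11: the Weil operator), proof of Thm. 4.8 (p. 48: (a′), (b′), positivity of `ψ(x, Jy)`).
* [VoisinHodgeI2002] C. Voisin, *Hodge Theory and Complex Algebraic Geometry I*, CUP 2002, §6.1.3 Cor. 6.12 (conjugation),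
  Thm. 6.32 (Hodge–Riemann), §7.1.2, §7.3.2 (pull-backs are morphisms of Hodge structures).
* [vanGeemen1994HodgeAV] B. van Geemen, *An introduction to the Hodge conjecture for abelian varieties*, LNM 1594 (1994),
  Lemma 5.2 (1).
* [Milne1999LefschetzClasses] J. S. Milne, *Lefschetz classes on abelian varieties*, Duke Math. J. 96 (1999), §1 pp. 642–644
  (the adjoint `β†`, `C(A)` is `†`-stable, `S(A)`).
* [BourbakiAlgebreVIII2012] N. Bourbaki, *Algèbre, Chapitre VIII*, Springer 2012, §1 n°2, §5 n°4 (bicommutant d'un module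
  semi-simple).
* [LangeBirkenhake1992] H. Lange, Ch. Birkenhake, *Complex Abelian Varieties* (1992), §5.1 (Rosati = adjoint), Thm. 4.2.1.
* [HatcherAT2002] A. Hatcher, *Algebraic Topology*, §3.2 Thm. 3.11 (graded commutativity).

## Provenance

Lane `lit-hodgefound` (Track 2, Layer A), prover seat `lit-hodgefound-p21` (generation 16), row g16-#1: successor note (a)
of the seat's generations 14/15 («factors with `m = 1` of type 3/4 where `B ⊊ End⁰(X)` — needs the double commutant for
`B ⊗ ℂ`») settled without the Albert classification.
-/

noncomputable section

open CategoryTheory Module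
open Literature.AlgebraicTopology.SingularHomology
open Literature.AlgebraicGeometry.Motives
open Literature.AlgebraicGeometry.VanGeemen1994 (pullbackOne)
open Literature.AlgebraicGeometry.Milne1999

namespace Literature.AlgebraicGeometry.HodgeTheory

namespace DivisorLefschetzGroup

variable {A : AbelianVariety ℂ} {h : complexBetti A.X 2}

/-! ## §1 Relations on `End(H¹(A(ℂ); ℂ))`: complex conjugates and `Q_h`-adjoints -/

section Conj

/-- **Existence of the complex conjugate `c̄ = σ ∘ c ∘ σ` of an endomorphism `c` of `H¹(A(ℂ); ℂ)`**
(`σ` = conjugation of coefficients, conjugate-linear, so `c̄` is `ℂ`-linear): `σ (c x) = c̄ (σ x)`.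
[cite: VoisinHodgeI2002, §6.1.3 Cor. 6.12] -/
theorem exists_conj (c : Module.End ℂ (complexBetti A.X 1)) :
    ∃ c' : Module.End ℂ (complexBetti A.X 1), ∀ x,
      conjClass (ComplexPoints A.X) 1 (c x) = c' (conjClass (ComplexPoints A.X) 1 x) := by
  let c' : Module.End ℂ (complexBetti A.X 1) :=
    { toFun := fun x ↦ conjClass (ComplexPoints A.X) 1 (c (conjClass (ComplexPoints A.X) 1 x))
      map_add' := fun x y ↦ by
        simp only [conjClass_add, map_add]
      map_smul' := fun a x ↦ by
        simp only [conjClass_smul, map_smul, RingHom.id_apply, starRingEnd_self_apply] }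
  refine ⟨c', fun x ↦ ?_⟩
  change _ = conjClass (ComplexPoints A.X) 1 (c (conjClass (ComplexPoints A.X) 1 (conjClass (ComplexPoints A.X) 1 x)))
  rw [conjClass_conjClass]

variable {c c' d d' : Module.End ℂ (complexBetti A.X 1)}

/-- The conjugate relation is symmetric: `σ (c̄ x) = c (σ x)`. [cite: VoisinHodgeI2002, §6.1.3 Cor. 6.12] -/
theorem conj_symm (hc : ∀ x, conjClass (ComplexPoints A.X) 1 (c x) = c' (conjClass (ComplexPoints A.X) 1 x))
    (x : complexBetti A.X 1) : conjClass (ComplexPoints A.X) 1 (c' x) = c (conjClass (ComplexPoints A.X) 1 x) := by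
  have e := hc (conjClass (ComplexPoints A.X) 1 x)
  rw [conjClass_conjClass] at e
  rw [← e, conjClass_conjClass]

/-- The conjugate is unique. [folklore] -/
private theorem conj_unique {c'' : Module.End ℂ (complexBetti A.X 1)}
    (hc : ∀ x, conjClass (ComplexPoints A.X) 1 (c x) = c' (conjClass (ComplexPoints A.X) 1 x))
    (hc' : ∀ x, conjClass (ComplexPoints A.X) 1 (c x) = c'' (conjClass (ComplexPoints A.X) 1 x)) : c' = c'' := by
  refine LinearMap.ext fun x ↦ ?_
  have e := hc (conjClass (ComplexPoints A.X) 1 x)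
  have e' := hc' (conjClass (ComplexPoints A.X) 1 x)
  rw [conjClass_conjClass] at e e'
  rw [← e, ← e']

/-- Conjugate of a sum. [folklore] -/
private theorem conj_add (hc : ∀ x, conjClass (ComplexPoints A.X) 1 (c x) = c' (conjClass (ComplexPoints A.X) 1 x))
    (hd : ∀ x, conjClass (ComplexPoints A.X) 1 (d x) = d' (conjClass (ComplexPoints A.X) 1 x))
    (x : complexBetti A.X 1) :
    conjClass (ComplexPoints A.X) 1 ((c + d) x) = (c' + d') (conjClass (ComplexPoints A.X) 1 x) := by
  rw [LinearMap.add_apply, LinearMap.add_apply, conjClass_add, hc, hd]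

/-- Conjugate of a scalar multiple (the scalar is conjugated). [folklore] -/
private theorem conj_smul (hc : ∀ x, conjClass (ComplexPoints A.X) 1 (c x) = c' (conjClass (ComplexPoints A.X) 1 x))
    (a : ℂ) (x : complexBetti A.X 1) :
    conjClass (ComplexPoints A.X) 1 ((a • c) x) = (starRingEnd ℂ a • c') (conjClass (ComplexPoints A.X) 1 x) := by
  rw [LinearMap.smul_apply, LinearMap.smul_apply, conjClass_smul, hc]

/-- Conjugate of a product. [folklore] -/
private theorem conj_mul (hc : ∀ x, conjClass (ComplexPoints A.X) 1 (c x) = c' (conjClass (ComplexPoints A.X) 1 x))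
    (hd : ∀ x, conjClass (ComplexPoints A.X) 1 (d x) = d' (conjClass (ComplexPoints A.X) 1 x))
    (x : complexBetti A.X 1) :
    conjClass (ComplexPoints A.X) 1 ((c * d) x) = (c' * d') (conjClass (ComplexPoints A.X) 1 x) := by
  rw [Module.End.mul_apply, Module.End.mul_apply, hc, hd]

/-- `1̄ = 1`. [folklore] -/
private theorem conj_one (x : complexBetti A.X 1) :
    conjClass (ComplexPoints A.X) 1 ((1 : Module.End ℂ (complexBetti A.X 1)) x) =
      (1 : Module.End ℂ (complexBetti A.X 1)) (conjClass (ComplexPoints A.X) 1 x) := rfl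

/-- **The pull-backs are real**: `σ (φ^* x) = φ^* (σ x)`. [cite: VoisinHodgeI2002, §6.1.3 Cor. 6.12] -/
theorem conj_pullbackOne (φ : A ⟶ A) (x : complexBetti A.X 1) :
    conjClass (ComplexPoints A.X) 1 (pullbackOne A φ x) = pullbackOne A φ (conjClass (ComplexPoints A.X) 1 x) :=
  conjClass_map _ x

/-- **The Weil operator is real**: `σ (C x) = C (σ x)`. [cite: Deligne1982HodgeCycles, §1 (p. 11)] -/
theorem conj_weilOperatorOne {n : ℕ} (hX : IsSmoothProjective n A.X) (x : complexBetti A.X 1) :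
    conjClass (ComplexPoints A.X) 1 (weilOperatorOne hX x) = weilOperatorOne hX (conjClass (ComplexPoints A.X) 1 x) :=
  conjClass_weilOperatorOne hX x

/-- The `ℂ`-span of the pull-backs is stable under conjugation. [cite: VoisinHodgeI2002, §6.1.3 Cor. 6.12] -/
theorem conj_mem_span_pullbackOne (hcP : c ∈ Submodule.span ℂ (Set.range fun φ : A ⟶ A ↦ pullbackOne A φ))
    (hc : ∀ x, conjClass (ComplexPoints A.X) 1 (c x) = c' (conjClass (ComplexPoints A.X) 1 x)) :
    c' ∈ Submodule.span ℂ (Set.range fun φ : A ⟶ A ↦ pullbackOne A φ) := by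
  -- the conjugate of an element of the span is in the span (induction), and conjugates are unique
  suffices H : ∀ e ∈ Submodule.span ℂ (Set.range fun φ : A ⟶ A ↦ pullbackOne A φ),
      ∃ e' ∈ Submodule.span ℂ (Set.range fun φ : A ⟶ A ↦ pullbackOne A φ),
        ∀ x, conjClass (ComplexPoints A.X) 1 (e x) = e' (conjClass (ComplexPoints A.X) 1 x) by
    obtain ⟨e', he', hce'⟩ := H c hcP
    rwa [conj_unique hc hce']
  intro e he
  induction he using Submodule.span_induction with
  | mem e he =>
    obtain ⟨φ, rfl⟩ := he
    exact ⟨pullbackOne A φ, Submodule.subset_span ⟨φ, rfl⟩, conj_pullbackOne φ⟩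
  | zero => exact ⟨0, Submodule.zero_mem _, fun x ↦ by simp [conjClass_zero]⟩
  | add e f _ _ he hf =>
    obtain ⟨e', he', hee'⟩ := he
    obtain ⟨f', hf', hff'⟩ := hf
    exact ⟨e' + f', Submodule.add_mem _ he' hf', conj_add hee' hff'⟩
  | smul a e _ he =>
    obtain ⟨e', he', hee'⟩ := he
    exact ⟨starRingEnd ℂ a • e', Submodule.smul_mem _ _ he', conj_smul hee' a⟩

end Conj

section Adjoint

variable {c c' c'' d d' : Module.End ℂ (complexBetti A.X 1)}

/-- **Conjugation commutes with the `Q_h`-adjoint** (`Q_h` is real for a rational `h`): if `c̄` is the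
conjugate of `c`, `c†` the adjoint of `c` and `\overline{c†}` the conjugate of `c†`, then `\overline{c†}` is the
adjoint of `c̄`. [cite: VoisinHodgeI2002, §6.1.3 Cor. 6.12] [cite: Milne1999LefschetzClasses, §1 p. 642] -/
theorem adjoint_conj (hQ : IsRationalClass h)
    (hc : ∀ x, conjClass (ComplexPoints A.X) 1 (c x) = c' (conjClass (ComplexPoints A.X) 1 x))
    (hadj : ∀ x y : complexBetti A.X 1,
      polarizationPairingOne A.X h (A.dim - 1) (c x) y = polarizationPairingOne A.X h (A.dim - 1) x (c'' y))
    {e : Module.End ℂ (complexBetti A.X 1)}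
    (he : ∀ x, conjClass (ComplexPoints A.X) 1 (c'' x) = e (conjClass (ComplexPoints A.X) 1 x))
    (x y : complexBetti A.X 1) :
    polarizationPairingOne A.X h (A.dim - 1) (c' x) y = polarizationPairingOne A.X h (A.dim - 1) x (e y) := by
  -- conjugate the identity `Q(c σx, σy) = Q(σx, c'' σy)`
  have key := congrArg (conjClass (ComplexPoints A.X) (2 + 2 * (A.dim - 1)))
    (hadj (conjClass (ComplexPoints A.X) 1 x) (conjClass (ComplexPoints A.X) 1 y))
  rw [conjClass_polarizationPairingOne hQ, conjClass_polarizationPairingOne hQ, hc, he] at key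
  simpa only [conjClass_conjClass] using key

/-- The adjoint of a sum. [cite: Milne1999LefschetzClasses, §1 p. 642] -/
theorem adjoint_add
    (hc : ∀ x y : complexBetti A.X 1,
      polarizationPairingOne A.X h (A.dim - 1) (c x) y = polarizationPairingOne A.X h (A.dim - 1) x (c' y))
    (hd : ∀ x y : complexBetti A.X 1,
      polarizationPairingOne A.X h (A.dim - 1) (d x) y = polarizationPairingOne A.X h (A.dim - 1) x (d' y))
    (x y : complexBetti A.X 1) :
    polarizationPairingOne A.X h (A.dim - 1) ((c + d) x) y = polarizationPairingOne A.X h (A.dim - 1) x ((c' + d') y) := by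
  rw [LinearMap.add_apply, LinearMap.add_apply, map_add, LinearMap.add_apply, map_add, hc, hd]

/-- The adjoint of a scalar multiple (`†` is `ℂ`-linear). [cite: Milne1999LefschetzClasses, §1 p. 642] -/
theorem adjoint_smul
    (hc : ∀ x y : complexBetti A.X 1,
      polarizationPairingOne A.X h (A.dim - 1) (c x) y = polarizationPairingOne A.X h (A.dim - 1) x (c' y))
    (a : ℂ) (x y : complexBetti A.X 1) :
    polarizationPairingOne A.X h (A.dim - 1) ((a • c) x) y = polarizationPairingOne A.X h (A.dim - 1) x ((a • c') y) := by
  rw [LinearMap.smul_apply, LinearMap.smul_apply, map_smul, LinearMap.smul_apply, map_smul, hc]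

/-- The identity is self-adjoint. [folklore] -/
private theorem adjoint_one (x y : complexBetti A.X 1) :
    polarizationPairingOne A.X h (A.dim - 1) ((1 : Module.End ℂ (complexBetti A.X 1)) x) y =
      polarizationPairingOne A.X h (A.dim - 1) x ((1 : Module.End ℂ (complexBetti A.X 1)) y) := rfl

end Adjoint

/-! ## §2 The Weil operator on `H¹(A(ℂ); ℂ)` against `Q_h`, and the hermitian form `H(x, y) = Q_h(x, C ȳ)` -/

section Weil

/-- Degree bookkeeping: `Q_h(Cx, Cy) = Q_h(x, y)` with the Weil operator of `IsSmoothProjective n X` and the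
pairing in degree `j`, `n = j + 1`. [cite: Deligne1982HodgeCycles, proof of Thm. 4.8, p. 48 (b′)] -/
theorem polarizationPairingOne_weilOperatorOne_of_eq {n j : ℕ} {X : SchemeOver ℂ} (hX : IsSmoothProjective n X)
    (hnj : n = j + 1) {h : complexBetti X 2} (hh : IsOfHodgeType n X 2 1 1 h) (x y : complexBetti X 1) :
    polarizationPairingOne X h j (weilOperatorOne hX x) (weilOperatorOne hX y) = polarizationPairingOne X h j x y := by
  subst hnj
  exact polarizationPairingOne_weilOperatorOne hX hh x y

/-- Degree bookkeeping for the positivity theorem (Hodge–Riemann in degree one): for `X` smooth projective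
of dimension `n = m + 1 ≥ 2` and a rational `h` with a Kähler multiple, `Q_h(x, Cx) = t ω₀`, `t > 0`, on the
non-zero real classes, for a non-zero rational generator `ω₀` of the top line.
[cite: Deligne1982HodgeCycles, proof of Thm. 4.8, (b′) p. 33] [cite: VoisinHodgeI2002, Thm. 6.32 and §7.1.2] -/
theorem exists_pos_of_eq {n m : ℕ} {X : SchemeOver ℂ} (hX : IsSmoothProjective n X) (hnm : n = m + 1)
    (hm : 1 ≤ m) {h : complexBetti X 2} (hQ : IsRationalClass h)
    (hK : ∃ s : ℝ, s ≠ 0 ∧ IsKaehlerClass n X ((s : ℂ) • h)) :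
    ∃ ω₀ : complexBetti X (2 + 2 * m), IsRationalClass ω₀ ∧ ω₀ ≠ 0 ∧
      Module.finrank ℂ (complexBetti X (2 + 2 * m)) = 1 ∧
      ∀ x : complexBetti X 1, conjClass (ComplexPoints X) 1 x = x → x ≠ 0 →
        ∃ t : ℝ, 0 < t ∧ polarizationPairingOne X h m x (weilOperatorOne hX x) = (t : ℂ) • ω₀ := by
  subst hnm
  obtain ⟨ω₀, h1, h2, h3⟩ :=
    Deligne1982.exists_pos_polarizationPairingOne_weilOperatorOne_of_isKaehlerClass_smul hm hX hQ hK
  exact ⟨ω₀, h1, h2, finrank_complexBetti_two_add_two_mul_eq_one hX, h3⟩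

/-- Degree bookkeeping for the positivity theorem in EVERY dimension `n = m + 1 ≥ 1` (Hodge–Riemann in degree one
holds for curves too, `HodgeRiemannDegreeOneAllDimensions`): for `X` smooth projective of dimension `n = m + 1` and a
class `h` with a non-zero real Kähler multiple (no rationality needed), `Q_h(x, Cx) = t ω₀`, `t > 0`, on the
non-zero real classes, for a non-zero rational generator `ω₀` of the top line.
[cite: Deligne1982HodgeCycles, proof of Thm. 4.8, (b′) p. 33] [cite: VoisinHodgeI2002, Thm. 6.32 and §7.1.2] -/
theorem exists_pos_of_eq' {n m : ℕ} {X : SchemeOver ℂ} (hX : IsSmoothProjective n X) (hnm : n = m + 1)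
    {h : complexBetti X 2} (hK : ∃ s : ℝ, s ≠ 0 ∧ IsKaehlerClass n X ((s : ℂ) • h)) :
    ∃ ω₀ : complexBetti X (2 + 2 * m), IsRationalClass ω₀ ∧ ω₀ ≠ 0 ∧
      Module.finrank ℂ (complexBetti X (2 + 2 * m)) = 1 ∧
      ∀ x : complexBetti X 1, conjClass (ComplexPoints X) 1 x = x → x ≠ 0 →
        ∃ t : ℝ, 0 < t ∧ polarizationPairingOne X h m x (weilOperatorOne hX x) = (t : ℂ) • ω₀ := by
  subst hnm
  obtain ⟨ω₀, h1, h2, h3⟩ := exists_pos_polarizationPairingOne_weilOperatorOne_of_isKaehlerClass_smul' hX hK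
  exact ⟨ω₀, h1, h2, finrank_complexBetti_two_add_two_mul_eq_one hX, h3⟩

variable (hX : IsSmoothProjective A.dim A.X)

/-- **`C` commutes with every pull-back `φ^*`** (pull-backs are morphisms of Hodge structures).
[cite: VoisinHodgeI2002, §7.3.2] -/
theorem weilOperatorOne_mul_pullbackOne (φ : A ⟶ A) :
    weilOperatorOne hX * pullbackOne A φ = pullbackOne A φ * weilOperatorOne hX :=
  commute_weilOperatorOne_map _ _

/-- `C` commutes with the `ℂ`-span of the pull-backs. [cite: VoisinHodgeI2002, §7.3.2] -/
theorem weilOperatorOne_comm_of_mem_span {c : Module.End ℂ (complexBetti A.X 1)}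
    (hc : c ∈ Submodule.span ℂ (Set.range fun φ : A ⟶ A ↦ pullbackOne A φ)) :
    weilOperatorOne hX * c = c * weilOperatorOne hX := by
  induction hc using Submodule.span_induction with
  | mem e he => obtain ⟨φ, rfl⟩ := he; exact weilOperatorOne_mul_pullbackOne hX φ
  | zero => simp
  | add e f _ _ he hf => rw [mul_add, add_mul, he, hf]
  | smul a e _ he => rw [mul_smul_comm, smul_mul_assoc, he]

/-- **`C` commutes with `S_λ ⊗ ℂ`, i.e. `C ∈ C(S_λ ⊗ ℂ)`** (the commutant of `S_λ ⊗ ℂ` in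
`End(H¹(A(ℂ); ℂ))`). [cite: MoonenZarhin1998WeilClasses, §1 (chunk p0002 L68–71)] [cite: VoisinHodgeI2002, §7.3.2] -/
theorem weilOperatorOne_mem_centralizer_symmetricPullbackSpan :
    weilOperatorOne hX ∈
      Subalgebra.centralizer ℂ (symmetricPullbackSpan A h : Set (Module.End ℂ (complexBetti A.X 1))) := by
  rw [Subalgebra.mem_centralizer_iff]
  intro T hT
  exact (weilOperatorOne_comm_of_mem_span hX (symmetricPullbackSpan_le_span hT)).symm

/-- `h` is of type `(1,1)` (it has a Kähler multiple). [cite: VoisinHodgeI2002, §7.1.2] -/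
theorem isOfHodgeType_one_one {s : ℝ} (hs : s ≠ 0) (hK : IsKaehlerClass A.dim A.X ((s : ℂ) • h)) :
    IsOfHodgeType A.dim A.X 2 1 1 h := by
  have e := (hK.isOfHodgeType_one_one).smul ((s : ℂ)⁻¹)
  rwa [smul_smul, inv_mul_cancel₀ (Complex.ofReal_ne_zero.2 hs), one_smul] at e

variable {s : ℝ} (hs : s ≠ 0) (hK : IsKaehlerClass A.dim A.X ((s : ℂ) • h))
include hs hK

/-- **`Q_h(Cx, Cy) = Q_h(x, y)`** on `H¹(A(ℂ); ℂ)` (Deligne's (b′) `ψ(Jx, Jy) = ψ(x, y)`), for a polarization class `h`.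
[cite: Deligne1982HodgeCycles, proof of Thm. 4.8, p. 48 (b′)] [cite: vanGeemen1994HodgeAV, Lemma 5.2 (1)] -/
theorem polarizationPairingOne_weilOperatorOne_weilOperatorOne (hA0 : 0 < A.dim) (x y : complexBetti A.X 1) :
    polarizationPairingOne A.X h (A.dim - 1) (weilOperatorOne hX x) (weilOperatorOne hX y) =
      polarizationPairingOne A.X h (A.dim - 1) x y :=
  polarizationPairingOne_weilOperatorOne_of_eq hX (Nat.sub_add_cancel hA0).symm (isOfHodgeType_one_one hs hK) x y

/-- **The `Q_h`-adjoint of `C` is `-C`** (`C` is a `Q_h`-isometry with `C² = -1`): `Q_h(Cx, y) = Q_h(x, -Cy)`.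
[cite: Deligne1982HodgeCycles, proof of Thm. 4.8, p. 48 (b′)] -/
theorem polarizationPairingOne_weilOperatorOne_left (hA0 : 0 < A.dim) (x y : complexBetti A.X 1) :
    polarizationPairingOne A.X h (A.dim - 1) (weilOperatorOne hX x) y =
      polarizationPairingOne A.X h (A.dim - 1) x ((-weilOperatorOne hX) y) := by
  have e := polarizationPairingOne_weilOperatorOne_weilOperatorOne hX hs hK hA0 x (weilOperatorOne hX y)
  rw [weilOperatorOne_weilOperatorOne, map_neg] at e
  rw [LinearMap.neg_apply, map_neg, ← e, neg_neg]

/-- **The form `(x, y) ↦ Q_h(x, Cy)` is symmetric**: `Q_h(x, Cy) = Q_h(y, Cx)` (`Q_h` alternating, `C` an isometry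
with `C² = -1`) — Deligne's «`ψ(x, Jy)` symmetric». [cite: Deligne1982HodgeCycles, proof of Thm. 4.8, (b′) p. 33] -/
theorem polarizationPairingOne_weilOperatorOne_symm (hA0 : 0 < A.dim) (x y : complexBetti A.X 1) :
    polarizationPairingOne A.X h (A.dim - 1) x (weilOperatorOne hX y) =
      polarizationPairingOne A.X h (A.dim - 1) y (weilOperatorOne hX x) := by
  rw [polarizationPairingOne_swap h (A.dim - 1) (weilOperatorOne hX y) x,
    polarizationPairingOne_weilOperatorOne_left hX hs hK hA0, LinearMap.neg_apply, map_neg, neg_neg]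

end Weil

/-! ## §2b The positive-definite hermitian form `H(x, y) = ℓ(Q_h(y, C x̄))` on `H¹(A(ℂ); ℂ)` -/

section Core

/-- **The hermitian form of the polarization** (Riemann's second bilinear relation read on `H¹`): for a complex
abelian variety `A` of positive dimension and a polarization class `h` (rational, `s · h` Kähler, `s ≠ 0`) there are
a coordinate `ℓ` of the top line `H^{2 dim A}(A(ℂ); ℂ) ≅ ℂ` (injective, real: `ℓ ∘ σ = conj ∘ ℓ`) and a
POSITIVE-DEFINITE hermitian inner product on `H¹(A(ℂ); ℂ)` with `⟪x, y⟫ = ℓ(Q_h(y, C x̄))`, `C` the Weil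
operator, `x̄` the complex conjugate (Hodge–Riemann in degree one: `Q_h(x, Cx) > 0` on real classes; for complex
`x = x₁ + i x₂`, `Q_h(x, C x̄) = Q_h(x₁, Cx₁) + Q_h(x₂, Cx₂)` because `(a, b) ↦ Q_h(a, Cb)` is symmetric).
[cite: Deligne1982HodgeCycles, proof of Thm. 4.8, (b′) p. 33 and p. 48] [cite: VoisinHodgeI2002, Thm. 6.32 and §7.1.2]
(Every positive dimension — elliptic curves included: Hodge–Riemann in degree one holds in every dimension,
`HodgeRiemannDegreeOneAllDimensions`; the unprimed statement below is the case `2 ≤ dim A`.) -/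
theorem exists_innerProductSpaceCore' (hA : 0 < A.dim) (hQ : IsRationalClass h) {s : ℝ} (hs : s ≠ 0)
    (hK : IsKaehlerClass A.dim A.X ((s : ℂ) • h)) (hX : IsSmoothProjective A.dim A.X) :
    ∃ (ℓ : complexBetti A.X (2 + 2 * (A.dim - 1)) →ₗ[ℂ] ℂ) (core : InnerProductSpace.Core ℂ (complexBetti A.X 1)),
      Function.Injective ℓ ∧
      (∀ w, ℓ (conjClass (ComplexPoints A.X) (2 + 2 * (A.dim - 1)) w) = starRingEnd ℂ (ℓ w)) ∧
      ∀ x y : complexBetti A.X 1, @inner ℂ _ core.toInner x y =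
        ℓ (polarizationPairingOne A.X h (A.dim - 1) y (weilOperatorOne hX (conjClass (ComplexPoints A.X) 1 x))) := by
  have hA0 : 0 < A.dim := hA
  have hA1 : A.dim = (A.dim - 1) + 1 := by omega
  -- Hodge–Riemann in degree one, with a rational generator of the top line
  obtain ⟨ω₀, hωrat, hω0, h1, hpos⟩ := exists_pos_of_eq' hX hA1 ⟨s, hs, hK⟩
  -- the coordinate `ℓ` along `ω₀`
  set b := FiniteDimensional.basisSingleton Unit h1 ω₀ hω0 with hb
  have hbapp : b default = ω₀ := FiniteDimensional.basisSingleton_apply Unit h1 ω₀ hω0 default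
  set ℓ : complexBetti A.X (2 + 2 * (A.dim - 1)) →ₗ[ℂ] ℂ := b.coord default with hℓ
  have hrepr : ∀ w, w = ℓ w • ω₀ := fun w ↦ by
    have e := b.sum_repr w
    rw [Fintype.sum_unique, hbapp] at e
    exact e.symm
  have hℓω : ℓ ω₀ = 1 := by
    have e : b.repr (b default) default = 1 := by rw [b.repr_self, Finsupp.single_eq_same]
    rw [hbapp] at e
    exact e
  have hℓsmul : ∀ t : ℂ, ℓ ((t : ℂ) • ω₀) = t := fun t ↦ by rw [map_smul, hℓω, smul_eq_mul, mul_one]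
  have hℓinj : Function.Injective ℓ := by
    intro v w hvw
    rw [hrepr v, hrepr w, hvw]
  have hℓconj : ∀ w, ℓ (conjClass (ComplexPoints A.X) (2 + 2 * (A.dim - 1)) w) = starRingEnd ℂ (ℓ w) := by
    intro w
    conv_lhs => rw [hrepr w, conjClass_smul, hωrat.conjClass_eq]
    exact hℓsmul _
  -- abbreviations
  set Q := polarizationPairingOne A.X h (A.dim - 1) with hQdef
  set J := weilOperatorOne hX with hJdef
  set σ := conjClass (ComplexPoints A.X) 1 with hσdef
  -- positivity on real classes, with `t ≥ 0` (and `t > 0` off `0`)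
  have hreal : ∀ y : complexBetti A.X 1, σ y = y → ∃ t : ℝ, 0 ≤ t ∧ ℓ (Q y (J y)) = t ∧ (y ≠ 0 → 0 < t) := by
    intro y hy
    by_cases hy0 : y = 0
    · refine ⟨0, le_rfl, ?_, fun h ↦ (h hy0).elim⟩
      rw [hy0, map_zero, LinearMap.zero_apply, map_zero, Complex.ofReal_zero]
    · obtain ⟨t, ht, hQt⟩ := hpos y hy hy0
      exact ⟨t, ht.le, by rw [hQt, hℓsmul], fun _ ↦ ht⟩
  -- the value on the diagonal: `Q(x, C x̄) = Q(x₁, Cx₁) + Q(x₂, Cx₂)` for the real parts `x₁, x₂`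
  have hdiag : ∀ x : complexBetti A.X 1, ∃ t : ℝ, 0 ≤ t ∧ ℓ (Q x (J (σ x))) = t ∧ (x ≠ 0 → 0 < t) := by
    intro x
    obtain ⟨x₁, hx₁⟩ : ∃ x₁ : complexBetti A.X 1, x₁ = ((2 : ℂ)⁻¹) • (x + σ x) := ⟨_, rfl⟩
    obtain ⟨x₂, hx₂⟩ : ∃ x₂ : complexBetti A.X 1, x₂ = (-(Complex.I / 2)) • (x - σ x) := ⟨_, rfl⟩
    have hx₁r : σ x₁ = x₁ := by
      rw [hx₁, hσdef, conjClass_smul, conjClass_add, conjClass_conjClass, map_inv₀, map_ofNat, add_comm]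
    have hx₂r : σ x₂ = x₂ := by
      rw [hx₂, hσdef, conjClass_smul, conjClass_sub, conjClass_conjClass, map_neg, map_div₀, Complex.conj_I,
        map_ofNat, neg_div, neg_neg, ← neg_sub x, smul_neg, neg_smul]
    have hI2 : Complex.I * -(Complex.I / 2) = (2 : ℂ)⁻¹ := by
      rw [mul_neg, ← mul_div_assoc, Complex.I_mul_I]; norm_num
    have hxdec : x = x₁ + Complex.I • x₂ := by
      rw [hx₁, hx₂, smul_smul, hI2, ← smul_add,
        show x + σ x + (x - σ x) = (2 : ℂ) • x by rw [two_smul]; abel,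
        smul_smul, inv_mul_cancel₀ (two_ne_zero), one_smul]
    have hσx : σ x = x₁ - Complex.I • x₂ := by
      have e := congrArg σ hxdec
      rw [hσdef, conjClass_add, conjClass_smul, Complex.conj_I, neg_smul, ← sub_eq_add_neg] at e
      rw [hσdef] at hx₁r hx₂r
      rw [hx₁r, hx₂r] at e
      exact e
    obtain ⟨t₁, ht₁, hℓ₁, hpos₁⟩ := hreal x₁ hx₁r
    obtain ⟨t₂, ht₂, hℓ₂, hpos₂⟩ := hreal x₂ hx₂r
    have hsymm : Q x₂ (J x₁) = Q x₁ (J x₂) :=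
      polarizationPairingOne_weilOperatorOne_symm hX hs hK hA0 x₂ x₁
    have hval : ℓ (Q x (J (σ x))) = t₁ + t₂ := by
      rw [hσx]
      conv_lhs => rw [hxdec]
      simp only [map_add, map_sub, map_smul, LinearMap.add_apply, LinearMap.smul_apply, hsymm, hℓ₁, hℓ₂,
        smul_eq_mul]
      linear_combination (-(t₂ : ℂ)) * Complex.I_mul_I
    refine ⟨t₁ + t₂, add_nonneg ht₁ ht₂, by rw [hval, Complex.ofReal_add], fun hx0 ↦ ?_⟩
    by_cases h₁ : x₁ = 0
    · have h₂ : x₂ ≠ 0 := by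
        intro h₂; apply hx0; rw [hxdec, h₁, h₂, smul_zero, add_zero]
      exact add_pos_of_nonneg_of_pos ht₁ (hpos₂ h₂)
    · exact add_pos_of_pos_of_nonneg (hpos₁ h₁) ht₂
  -- the core
  let core : InnerProductSpace.Core ℂ (complexBetti A.X 1) :=
    { inner := fun x y ↦ ℓ (Q y (J (σ x)))
      conj_inner_symm := fun x y ↦ by
        change starRingEnd ℂ (ℓ (Q x (J (σ y)))) = ℓ (Q y (J (σ x)))
        rw [← hℓconj, hQdef, conjClass_polarizationPairingOne hQ, ← hQdef, hJdef, hσdef,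
          conjClass_weilOperatorOne, conjClass_conjClass]
        exact congrArg ℓ (polarizationPairingOne_weilOperatorOne_symm hX hs hK hA0 _ _)
      re_inner_nonneg := fun x ↦ by
        obtain ⟨t, ht, hℓt, -⟩ := hdiag x
        rw [hℓt]
        simpa using ht
      add_left := fun x y z ↦ by
        change ℓ (Q z (J (σ (x + y)))) = ℓ (Q z (J (σ x))) + ℓ (Q z (J (σ y)))
        rw [hσdef, conjClass_add, map_add, map_add, map_add]
      smul_left := fun x y r ↦ by
        change ℓ (Q y (J (σ (r • x)))) = starRingEnd ℂ r * ℓ (Q y (J (σ x)))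
        rw [hσdef, conjClass_smul, map_smul, map_smul, map_smul, smul_eq_mul]
      definite := fun x hx ↦ by
        change ℓ (Q x (J (σ x))) = 0 at hx
        obtain ⟨t, -, hℓt, hpos⟩ := hdiag x
        by_contra hx0
        have := hpos hx0
        rw [hℓt, Complex.ofReal_eq_zero] at hx
        exact this.ne' hx }
  exact ⟨ℓ, core, hℓinj, hℓconj, fun x y ↦ rfl⟩

/-- **The hermitian form of the polarization** (Riemann's second bilinear relation read on `H¹`): for a complex
abelian variety `A` of dimension `≥ 2` and a polarization class `h` (rational, `s · h` Kähler, `s ≠ 0`) there are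
a coordinate `ℓ` of the top line `H^{2 dim A}(A(ℂ); ℂ) ≅ ℂ` (injective, real: `ℓ ∘ σ = conj ∘ ℓ`) and a
POSITIVE-DEFINITE hermitian inner product on `H¹(A(ℂ); ℂ)` with `⟪x, y⟫ = ℓ(Q_h(y, C x̄))`, `C` the Weil
operator, `x̄` the complex conjugate (Hodge–Riemann in degree one: `Q_h(x, Cx) > 0` on real classes; for complex
`x = x₁ + i x₂`, `Q_h(x, C x̄) = Q_h(x₁, Cx₁) + Q_h(x₂, Cx₂)` because `(a, b) ↦ Q_h(a, Cb)` is symmetric).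
[cite: Deligne1982HodgeCycles, proof of Thm. 4.8, (b′) p. 33 and p. 48] [cite: VoisinHodgeI2002, Thm. 6.32 and §7.1.2]
(The case `2 ≤ dim A`, kept for the record; `exists_innerProductSpaceCore'` is every positive dimension.) -/
theorem exists_innerProductSpaceCore (h2 : 2 ≤ A.dim) (hQ : IsRationalClass h) {s : ℝ} (hs : s ≠ 0)
    (hK : IsKaehlerClass A.dim A.X ((s : ℂ) • h)) (hX : IsSmoothProjective A.dim A.X) :
    ∃ (ℓ : complexBetti A.X (2 + 2 * (A.dim - 1)) →ₗ[ℂ] ℂ) (core : InnerProductSpace.Core ℂ (complexBetti A.X 1)),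
      Function.Injective ℓ ∧
      (∀ w, ℓ (conjClass (ComplexPoints A.X) (2 + 2 * (A.dim - 1)) w) = starRingEnd ℂ (ℓ w)) ∧
      ∀ x y : complexBetti A.X 1, @inner ℂ _ core.toInner x y =
        ℓ (polarizationPairingOne A.X h (A.dim - 1) y (weilOperatorOne hX (conjClass (ComplexPoints A.X) 1 x))) :=
  exists_innerProductSpaceCore' (lt_of_lt_of_le Nat.zero_lt_two h2) hQ hs hK hX

end Core

/-! ## §3 The `ℂ`-span of `G_div(X)(ℂ)` is the whole commutant `C(S_λ ⊗ ℂ)` -/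

section Span

/-- Inverse-closedness of finite-dimensional subalgebras: a subalgebra containing a unit contains its inverse
(left multiplication by the unit is an injective, hence surjective, endomorphism of the subalgebra).
[cite: BourbakiAlgebreVIII2012, §1 n°2] -/
theorem val_inv_mem_of_mem {K R : Type*} [Field K] [Ring R] [Algebra K R] (S : Subalgebra K R)
    [FiniteDimensional K S] (u : Rˣ) (hu : (u : R) ∈ S) : (↑u⁻¹ : R) ∈ S := by
  let f : S →ₗ[K] S :=
    { toFun := fun b ↦ ⟨(u : R) * b, S.mul_mem hu b.2⟩
      map_add' := fun b c ↦ Subtype.ext (mul_add _ _ _)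
      map_smul' := fun r b ↦ Subtype.ext (by simp [Algebra.mul_smul_comm]) }
  have hinj : Function.Injective f := by
    intro b c hbc
    have e : (u : R) * b = (u : R) * c := congrArg Subtype.val hbc
    exact Subtype.ext (by simpa using congrArg (fun r ↦ (↑u⁻¹ : R) * r) e)
  obtain ⟨b, hb⟩ := (LinearMap.injective_iff_surjective.1 hinj) ⟨1, S.one_mem⟩
  have e : (u : R) * b = 1 := congrArg Subtype.val hb
  have : (↑u⁻¹ : R) = b := by
    calc (↑u⁻¹ : R) = ↑u⁻¹ * ((u : R) * b) := by rw [e, mul_one]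
      _ = b := by rw [← mul_assoc, Units.inv_mul, one_mul]
  rw [this]
  exact b.2

/-- Subalgebras of `End(H¹(A(ℂ); ℂ))` are finite-dimensional. [folklore] -/
private theorem finiteDimensional_subalgebra (S : Subalgebra ℂ (Module.End ℂ (complexBetti A.X 1))) :
    FiniteDimensional ℂ S := by
  haveI : Module.Finite ℂ (complexBetti A.X 1) := abelianVarietyCohomologyExteriorH1_holds.finite_one A
  exact FiniteDimensional.of_injective S.val.toLinearMap Subtype.val_injective

/-- **The Cayley transform: a `Q_h`-skew element of the commutant of `S_λ ⊗ ℂ` lies in the `ℂ`-span of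
`G_div(X)(ℂ)`.** For `k` commuting with `S_λ ⊗ ℂ` with `Q_h(kx, y) = -Q_h(x, ky)`, and `t ≠ 0` off the
(finitely many) inverses of eigenvalues of `±k`, `u_t = (1 + tk)(1 - tk)⁻¹` commutes with `S_λ ⊗ ℂ` and preserves
`Q_h` — an element of `G_div(X)(ℂ) = Gl_B(V) ∩ Sp(V, φ)` — and `(1 - tk)⁻¹ = ½(1 + u_t)`; the subalgebra generated
by `G_div(X)(ℂ)` is inverse-closed (finite dimension), so it contains `1 - tk`, hence `k`.
[cite: MoonenZarhin1998WeilClasses, §1 (chunk p0002 L68–71: G_div(X) := Gl_B(V) ∩ SP(V, φ))] -/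
theorem mem_adjoin_divisorLefschetzGroup_of_skew {k : Module.End ℂ (complexBetti A.X 1)}
    (hkC : k ∈ Subalgebra.centralizer ℂ (symmetricPullbackSpan A h : Set (Module.End ℂ (complexBetti A.X 1))))
    (hskew : ∀ x y : complexBetti A.X 1,
      polarizationPairingOne A.X h (A.dim - 1) (k x) y = -polarizationPairingOne A.X h (A.dim - 1) x (k y)) :
    k ∈ Algebra.adjoin ℂ ((fun u : complexBetti A.X 1 ≃ₗ[ℂ] complexBetti A.X 1 ↦
      (u : Module.End ℂ (complexBetti A.X 1))) '' (divisorLefschetzGroup A h : Set (complexBetti A.X 1 ≃ₗ[ℂ] complexBetti A.X 1))) := by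
  haveI : Module.Finite ℂ (complexBetti A.X 1) := abelianVarietyCohomologyExteriorH1_holds.finite_one A
  set Q := polarizationPairingOne A.X h (A.dim - 1) with hQdef
  set C := Subalgebra.centralizer ℂ (symmetricPullbackSpan A h : Set (Module.End ℂ (complexBetti A.X 1))) with hCdef
  set S := Algebra.adjoin ℂ ((fun u : complexBetti A.X 1 ≃ₗ[ℂ] complexBetti A.X 1 ↦
      (u : Module.End ℂ (complexBetti A.X 1))) '' (divisorLefschetzGroup A h : Set (complexBetti A.X 1 ≃ₗ[ℂ] complexBetti A.X 1)))
    with hSdef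
  haveI : FiniteDimensional ℂ C := finiteDimensional_subalgebra C
  haveI : FiniteDimensional ℂ S := finiteDimensional_subalgebra S
  -- (1) a scalar `t ≠ 0` with `1 ± t k` invertible
  have hfin : Set.Finite {μ : ℂ | k.HasEigenvalue μ} := k.finite_hasEigenvalue
  obtain ⟨t, ht⟩ := (((hfin.image fun μ ↦ μ⁻¹).union (hfin.image fun μ ↦ -μ⁻¹)).union
    (Set.finite_singleton (0 : ℂ))).exists_notMem
  simp only [Set.mem_union, Set.mem_image, Set.mem_setOf_eq, Set.mem_singleton_iff, not_or, not_exists,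
    not_and] at ht
  obtain ⟨⟨ht₁, ht₂⟩, ht0⟩ := ht
  have hunit : ∀ ε : ℂ, (ε = 1 ∨ ε = -1) → IsUnit (1 + (ε * t) • k) := by
    intro ε hε
    rw [LinearMap.isUnit_iff_ker_eq_bot, LinearMap.ker_eq_bot']
    intro x hx
    rw [LinearMap.add_apply, Module.End.one_apply, LinearMap.smul_apply] at hx
    by_contra hx0
    -- `x` is an eigenvector of `k` for `-(ε t)⁻¹`
    have hkx : k x = (-(ε * t)⁻¹) • x := by
      have hεt : ε * t ≠ 0 := mul_ne_zero (by rcases hε with rfl | rfl <;> norm_num) ht0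
      have e : (ε * t) • k x = -x := eq_neg_of_add_eq_zero_right hx
      calc k x = (ε * t)⁻¹ • ((ε * t) • k x) := by rw [smul_smul, inv_mul_cancel₀ hεt, one_smul]
        _ = (-(ε * t)⁻¹) • x := by rw [e, smul_neg, neg_smul]
    have hev : k.HasEigenvalue (-(ε * t)⁻¹) :=
      Module.End.hasEigenvalue_of_hasEigenvector ⟨Module.End.mem_eigenspace_iff.2 hkx, hx0⟩
    rcases hε with rfl | rfl
    · exact ht₂ _ hev (by rw [one_mul, inv_neg, inv_inv, neg_neg])
    · exact ht₁ _ hev (by rw [neg_one_mul, inv_neg, inv_inv, neg_neg])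
  have hp : IsUnit (1 + t • k) := by simpa using hunit 1 (Or.inl rfl)
  have hm : IsUnit (1 + (-t) • k) := by simpa using hunit (-1) (Or.inr rfl)
  set p := 1 + t • k with hpdef
  set m := 1 + (-t) • k with hmdef
  obtain ⟨um, hum⟩ := hm
  obtain ⟨up, hup⟩ := hp
  -- (2) `u_t = p m⁻¹` is an element of `G_div(X)(ℂ)`
  have hkC' : ∀ T ∈ symmetricPullbackSpan A h, T * k = k * T := (Subalgebra.mem_centralizer_iff ℂ).1 hkC
  have hpC : p ∈ C := C.add_mem C.one_mem (C.smul_mem hkC t)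
  have hmC : m ∈ C := C.add_mem C.one_mem (C.smul_mem hkC (-t))
  have hmiC : (↑um⁻¹ : Module.End ℂ (complexBetti A.X 1)) ∈ C := val_inv_mem_of_mem C um (by rw [hum]; exact hmC)
  set g := p * ↑um⁻¹ with hgdef
  have hgC : g ∈ C := C.mul_mem hpC hmiC
  have hpm : p * m = m * p := by
    simp only [hpdef, hmdef, mul_add, add_mul, one_mul, mul_one, smul_mul_assoc, mul_smul_comm]
    module
  -- `Q(p a, p b) = Q(m a, m b)`
  have hQpm : ∀ a b, Q (p a) (p b) = Q (m a) (m b) := by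
    intro a b
    simp only [hpdef, hmdef, LinearMap.add_apply, Module.End.one_apply, LinearMap.smul_apply, map_add, map_smul,
      LinearMap.add_apply, LinearMap.smul_apply, hskew a]
    module
  have hgQ : ∀ x y, Q (g x) (g y) = Q x y := by
    intro x y
    have hmx : m ((↑um⁻¹ : Module.End ℂ (complexBetti A.X 1)) x) = x := by
      rw [← hum, ← Module.End.mul_apply, Units.mul_inv, Module.End.one_apply]
    have hmy : m ((↑um⁻¹ : Module.End ℂ (complexBetti A.X 1)) y) = y := by
      rw [← hum, ← Module.End.mul_apply, Units.mul_inv, Module.End.one_apply]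
    rw [hgdef, Module.End.mul_apply, Module.End.mul_apply, hQpm, hmx, hmy]
  have hgunit : IsUnit g := (hup ▸ up.isUnit).mul (um⁻¹).isUnit
  obtain ⟨ug, hug⟩ := hgunit
  set u : complexBetti A.X 1 ≃ₗ[ℂ] complexBetti A.X 1 := LinearMap.GeneralLinearGroup.toLinearEquiv ug with hudef
  have hucoe : (u : Module.End ℂ (complexBetti A.X 1)) = g := by
    rw [← hug]; rfl
  have huG : u ∈ divisorLefschetzGroup A h := by
    refine ⟨fun T hT x ↦ ?_, fun x y ↦ ?_⟩
    · have e := (Subalgebra.mem_centralizer_iff ℂ).1 hgC T hT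
      have ex := LinearMap.congr_fun e x
      rw [Module.End.mul_apply, Module.End.mul_apply] at ex
      rw [← LinearEquiv.coe_coe, hucoe]
      exact ex.symm
    · rw [← LinearEquiv.coe_coe, hucoe]
      exact hgQ x y
  -- (3) membership: `g ∈ S`, `(1 - t k)⁻¹ = ½ (1 + g) ∈ S`, `1 - t k ∈ S`, `k ∈ S`
  have hgS : g ∈ S := by
    rw [← hucoe]
    exact Algebra.subset_adjoin ⟨u, huG, rfl⟩
  have hmi : (↑um⁻¹ : Module.End ℂ (complexBetti A.X 1)) = (2 : ℂ)⁻¹ • (1 + g) := by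
    have e1 : (1 : Module.End ℂ (complexBetti A.X 1)) = m * ↑um⁻¹ := by rw [← hum, Units.mul_inv]
    have e2 : 1 + g = (m + p) * ↑um⁻¹ := by rw [add_mul, ← e1]
    have e3 : m + p = (2 : ℂ) • (1 : Module.End ℂ (complexBetti A.X 1)) := by
      rw [hmdef, hpdef, two_smul]; module
    rw [e2, e3, smul_mul_assoc, one_mul, smul_smul, inv_mul_cancel₀ two_ne_zero, one_smul]
  have hmiS : (↑um⁻¹ : Module.End ℂ (complexBetti A.X 1)) ∈ S := by
    rw [hmi]
    exact S.smul_mem (S.add_mem S.one_mem hgS) _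
  have hmS : m ∈ S := by
    have e := val_inv_mem_of_mem S (um⁻¹) hmiS
    rwa [inv_inv, hum] at e
  have htk : t • k = 1 - m := by rw [hmdef]; module
  have hk : k = t⁻¹ • (t • k) := by rw [smul_smul, inv_mul_cancel₀ ht0, one_smul]
  rw [hk, htk]
  exact S.smul_mem (S.sub_mem S.one_mem hmS) _

end Span

/-! ### §3.2 Spectral projections of a symmetric operator (finite-dimensional inner product spaces) -/

section Spectral

variable {E : Type*} [NormedAddCommGroup E] [InnerProductSpace ℂ E] [FiniteDimensional ℂ E]

open LinearMap Module.End

/-- The orthogonal projection onto an eigenspace lands in the eigenspace. [folklore] -/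
private theorem starProjection_eigenspace_apply_mem (T : E →ₗ[ℂ] E) (μ : ℂ) (x : E) :
    (((eigenspace T μ).starProjection : E →L[ℂ] E) : Module.End ℂ E) x ∈ eigenspace T μ :=
  Submodule.starProjection_apply_mem _ x

/-- The orthogonal projection onto an eigenspace fixes the eigenspace. [folklore] -/
private theorem starProjection_eigenspace_apply_of_mem {T : E →ₗ[ℂ] E} {μ : ℂ} {x : E} (hx : x ∈ eigenspace T μ) :
    (((eigenspace T μ).starProjection : E →L[ℂ] E) : Module.End ℂ E) x = x :=
  Submodule.starProjection_eq_self_iff.2 hx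

/-- Distinct eigenspaces of a symmetric operator: the projection onto `E_μ` kills `E_ν`. [folklore] -/
private theorem starProjection_eigenspace_apply_of_mem_ne {T : E →ₗ[ℂ] E} (hT : T.IsSymmetric) {μ ν : ℂ}
    (hμν : μ ≠ ν) {x : E} (hx : x ∈ eigenspace T ν) :
    (((eigenspace T μ).starProjection : E →L[ℂ] E) : Module.End ℂ E) x = 0 := by
  rw [ContinuousLinearMap.coe_coe, Submodule.starProjection_apply_eq_zero_iff, Submodule.mem_orthogonal']
  intro u hu
  exact hT.orthogonalFamily_eigenspaces hμν.symm ⟨x, hx⟩ ⟨u, hu⟩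

/-- `∑_μ P_μ = id` for a symmetric `T` on a finite-dimensional inner product space. [folklore] -/
private theorem sum_starProjection_eigenspace_apply {T : E →ₗ[ℂ] E} (hT : T.IsSymmetric) (x : E) :
    ∑ μ : Eigenvalues T, (((eigenspace T (μ : ℂ)).starProjection : E →L[ℂ] E) : Module.End ℂ E) x = x := by
  have htop : (⨆ μ : Eigenvalues T, eigenspace T (μ : ℂ)) = ⊤ :=
    Submodule.orthogonal_eq_bot_iff.mp hT.orthogonalComplement_iSup_eigenspaces_eq_bot'
  have hx : x ∈ ⨆ μ : Eigenvalues T, eigenspace T (μ : ℂ) := by rw [htop]; exact Submodule.mem_top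
  exact hT.orthogonalFamily_eigenspaces'.sum_projection_of_mem_iSup x hx

/-- **Spectral decomposition `T = ∑_μ μ P_μ`** of a symmetric operator. [folklore] -/
private theorem eq_sum_smul_starProjection_eigenspace {T : E →ₗ[ℂ] E} (hT : T.IsSymmetric) :
    T = ∑ μ : Eigenvalues T, (μ : ℂ) • (((eigenspace T (μ : ℂ)).starProjection : E →L[ℂ] E) : Module.End ℂ E) := by
  refine LinearMap.ext fun x ↦ ?_
  conv_lhs => rw [← sum_starProjection_eigenspace_apply hT x]
  rw [map_sum, LinearMap.sum_apply]
  refine Finset.sum_congr rfl fun μ _ ↦ ?_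
  rw [LinearMap.smul_apply]
  exact mem_eigenspace_iff.1 (starProjection_eigenspace_apply_mem T (μ : ℂ) x)

/-- An operator commuting with `T` commutes with the spectral projections of `T`. [folklore] -/
private theorem starProjection_eigenspace_comm_of_comm {T : E →ₗ[ℂ] E} (hT : T.IsSymmetric) {s : E →ₗ[ℂ] E}
    (hs : s * T = T * s) (μ : Eigenvalues T) (x : E) :
    (((eigenspace T (μ : ℂ)).starProjection : E →L[ℂ] E) : Module.End ℂ E) (s x) =
      s ((((eigenspace T (μ : ℂ)).starProjection : E →L[ℂ] E) : Module.End ℂ E) x) := by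
  have hpres : ∀ (ν : ℂ) (y : E), y ∈ eigenspace T ν → s y ∈ eigenspace T ν := by
    intro ν y hy
    rw [mem_eigenspace_iff] at hy ⊢
    have e := LinearMap.congr_fun hs y
    simp only [Module.End.mul_apply] at e
    rw [← e, hy, map_smul]
  conv_lhs => rw [← sum_starProjection_eigenspace_apply hT x]
  rw [map_sum, map_sum, Finset.sum_eq_single μ]
  · exact starProjection_eigenspace_apply_of_mem (hpres _ _ (starProjection_eigenspace_apply_mem T _ x))
  · intro ν _ hνμ
    exact starProjection_eigenspace_apply_of_mem_ne hT (fun e ↦ hνμ (Subtype.ext e.symm))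
      (hpres _ _ (starProjection_eigenspace_apply_mem T _ x))
  · intro h; exact absurd (Finset.mem_univ μ) h

/-- Spectral projections are symmetric for every bilinear pairing `B` with `B(Tx, y) = B(x, Ty)` (distinct
eigenspaces are `B`-orthogonal). [folklore] -/
private theorem starProjection_eigenspace_symm_of_symm {T : E →ₗ[ℂ] E} (hT : T.IsSymmetric) {L : Type*}
    [AddCommGroup L] [Module ℂ L] (B : E →ₗ[ℂ] E →ₗ[ℂ] L) (hB : ∀ x y, B (T x) y = B x (T y))
    (μ : Eigenvalues T) (x y : E) :
    B ((((eigenspace T (μ : ℂ)).starProjection : E →L[ℂ] E) : Module.End ℂ E) x) y =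
      B x ((((eigenspace T (μ : ℂ)).starProjection : E →L[ℂ] E) : Module.End ℂ E) y) := by
  have horth : ∀ (a b : ℂ), a ≠ b → ∀ u ∈ eigenspace T a, ∀ v ∈ eigenspace T b, B u v = 0 := by
    intro a b hab u hu v hv
    rw [mem_eigenspace_iff] at hu hv
    have e := hB u v
    rw [hu, hv, map_smul, LinearMap.smul_apply, map_smul] at e
    have : (a - b) • B u v = 0 := by rw [sub_smul, e, sub_self]
    exact (smul_eq_zero.1 this).resolve_left (sub_ne_zero.2 hab)
  set P := fun ν : Eigenvalues T ↦ (((eigenspace T (ν : ℂ)).starProjection : E →L[ℂ] E) : Module.End ℂ E) with hP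
  have lhs : B (P μ x) y = B (P μ x) (P μ y) := by
    conv_lhs => rw [← sum_starProjection_eigenspace_apply hT y]
    rw [map_sum, Finset.sum_eq_single μ]
    · intro ν _ hνμ
      exact horth _ _ (fun e ↦ hνμ (Subtype.ext e.symm)) _ (starProjection_eigenspace_apply_mem T _ x) _
        (starProjection_eigenspace_apply_mem T _ y)
    · intro h; exact absurd (Finset.mem_univ μ) h
  have rhs : B x (P μ y) = B (P μ x) (P μ y) := by
    conv_lhs => rw [← sum_starProjection_eigenspace_apply hT x]
    rw [map_sum, LinearMap.sum_apply, Finset.sum_eq_single μ]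
    · intro ν _ hνμ
      exact horth _ _ (fun e ↦ hνμ (Subtype.ext e)) _ (starProjection_eigenspace_apply_mem T _ x) _
        (starProjection_eigenspace_apply_mem T _ y)
    · intro h; exact absurd (Finset.mem_univ μ) h
  exact lhs.trans rhs.symm

/-- **An adjoint-closed subalgebra of `End(E)` acts semisimply** (`E` a finite-dimensional inner product space):
the orthogonal complement of an invariant subspace is invariant. [cite: BourbakiAlgebreVIII2012, §5 n°4] -/
private theorem isSemisimpleModule_of_adjoint_mem (R : Subalgebra ℂ (Module.End ℂ E))
    (hR : ∀ r ∈ R, LinearMap.adjoint r ∈ R) : IsSemisimpleModule R E := by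
  refine { exists_isCompl := fun N ↦ ?_ }
  let M : Submodule ℂ E :=
    { carrier := N
      add_mem' := fun ha hb ↦ N.add_mem ha hb
      zero_mem' := N.zero_mem
      smul_mem' := fun z x hx ↦ by
        have e : (⟨algebraMap ℂ (Module.End ℂ E) z, R.algebraMap_mem z⟩ : R) • x = z • x := by
          change algebraMap ℂ (Module.End ℂ E) z x = z • x
          simp
        rw [← e]
        exact N.smul_mem _ hx }
  let N' : Submodule R E :=
    { carrier := Mᗮ
      add_mem' := fun ha hb ↦ Mᗮ.add_mem ha hb
      zero_mem' := Mᗮ.zero_mem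
      smul_mem' := fun r y hy ↦ by
        have hy' : y ∈ Mᗮ := hy
        change (r : Module.End ℂ E) y ∈ Mᗮ
        rw [Submodule.mem_orthogonal] at hy' ⊢
        intro m hm
        rw [← LinearMap.adjoint_inner_left]
        refine hy' _ ?_
        change (⟨LinearMap.adjoint (r : Module.End ℂ E), hR _ r.2⟩ : R) • m ∈ N
        exact N.smul_mem _ hm }
  refine ⟨N', ?_, ?_⟩
  · rw [disjoint_iff, Submodule.eq_bot_iff]
    intro x hx
    have := (Submodule.isCompl_orthogonal (K := M)).disjoint
    rw [disjoint_iff, Submodule.eq_bot_iff] at this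
    exact this x ⟨(hx.1 : x ∈ M), (hx.2 : x ∈ Mᗮ)⟩
  · rw [codisjoint_iff, eq_top_iff]
    intro x _
    have hx : x ∈ M ⊔ Mᗮ := by
      rw [(Submodule.isCompl_orthogonal (K := M)).sup_eq_top]
      exact Submodule.mem_top
    obtain ⟨p, hp, q, hq, rfl⟩ := Submodule.mem_sup.1 hx
    exact Submodule.add_mem _ (Submodule.mem_sup_left (show p ∈ N from hp))
      (Submodule.mem_sup_right (show q ∈ N' from hq))

end Spectral

/-! ### §3.3 `Q_h`-symmetric, `θ`-fixed elements of the commutant lie in the span of `G_div(X)(ℂ)` -/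

section Symm

/-- **A `Q_h`-symmetric element `a` of the commutant of `S_λ ⊗ ℂ`, fixed by `θ(c) = C c̄ C⁻¹` (i.e.
`C ā = a C`), lies in the `ℂ`-span of `G_div(X)(ℂ)`.** Such an `a` is self-adjoint for the positive-definite
hermitian form `⟪x, y⟫ = ℓ(Q_h(y, C x̄))` (§2b), hence `a = ∑ μ P_μ` with spectral projections `P_μ` commuting
with `S_λ ⊗ ℂ` and `Q_h`-symmetric; the reflections `1 - 2P_μ` commute with `S_λ ⊗ ℂ` and preserve `Q_h`, i.e.
lie in `G_div(X)(ℂ)`, and `P_μ = ½(1 - (1 - 2P_μ))`.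
[cite: MoonenZarhin1998WeilClasses, §1 (chunk p0002 L68–71)] [cite: Deligne1982HodgeCycles, proof of Thm. 4.8, (b′) p. 33]
(Every positive dimension — elliptic curves included: Hodge–Riemann in degree one holds in every dimension,
`HodgeRiemannDegreeOneAllDimensions`; the unprimed statement below is the case `2 ≤ dim A`.) -/
theorem mem_adjoin_divisorLefschetzGroup_of_symm' (hA : 0 < A.dim) (hQ : IsRationalClass h) {s : ℝ} (hs : s ≠ 0)
    (hK : IsKaehlerClass A.dim A.X ((s : ℂ) • h)) (hX : IsSmoothProjective A.dim A.X)
    {a a' : Module.End ℂ (complexBetti A.X 1)}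
    (haC : a ∈ Subalgebra.centralizer ℂ (symmetricPullbackSpan A h : Set (Module.End ℂ (complexBetti A.X 1))))
    (hsym : ∀ x y : complexBetti A.X 1,
      polarizationPairingOne A.X h (A.dim - 1) (a x) y = polarizationPairingOne A.X h (A.dim - 1) x (a y))
    (hconj : ∀ x, conjClass (ComplexPoints A.X) 1 (a x) = a' (conjClass (ComplexPoints A.X) 1 x))
    (hθ : weilOperatorOne hX * a' = a * weilOperatorOne hX) :
    a ∈ Algebra.adjoin ℂ ((fun u : complexBetti A.X 1 ≃ₗ[ℂ] complexBetti A.X 1 ↦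
      (u : Module.End ℂ (complexBetti A.X 1))) '' (divisorLefschetzGroup A h : Set (complexBetti A.X 1 ≃ₗ[ℂ] complexBetti A.X 1))) := by
  haveI hfin : Module.Finite ℂ (complexBetti A.X 1) := abelianVarietyCohomologyExteriorH1_holds.finite_one A
  obtain ⟨ℓ, core, hℓinj, hℓconj, hinner⟩ := exists_innerProductSpaceCore' hA hQ hs hK hX
  letI : NormedAddCommGroup (complexBetti A.X 1) := @InnerProductSpace.Core.toNormedAddCommGroup ℂ _ _ _ _ core
  letI : InnerProductSpace ℂ (complexBetti A.X 1) := InnerProductSpace.ofCore _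
  haveI : FiniteDimensional ℂ (complexBetti A.X 1) := hfin
  set S := Algebra.adjoin ℂ ((fun u : complexBetti A.X 1 ≃ₗ[ℂ] complexBetti A.X 1 ↦
      (u : Module.End ℂ (complexBetti A.X 1))) '' (divisorLefschetzGroup A h : Set (complexBetti A.X 1 ≃ₗ[ℂ] complexBetti A.X 1)))
    with hSdef
  -- `a` is self-adjoint for `⟪·, ·⟫`
  have hsa : (a : complexBetti A.X 1 →ₗ[ℂ] complexBetti A.X 1).IsSymmetric := by
    intro x y
    change @inner ℂ _ core.toInner (a x) y = @inner ℂ _ core.toInner x (a y)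
    rw [hinner, hinner, hconj, ← Module.End.mul_apply, hθ, Module.End.mul_apply,
      polarizationPairingOne_apply_right_eq_of_adjoint hsym y]
  -- each spectral projection lies in `S`, through the reflection `1 - 2P ∈ G_div(X)(ℂ)`
  have hP : ∀ μ : Module.End.Eigenvalues a,
      (((Module.End.eigenspace a (μ : ℂ)).starProjection : complexBetti A.X 1 →L[ℂ] complexBetti A.X 1) :
        Module.End ℂ (complexBetti A.X 1)) ∈ S := by
    intro μ
    set P := (((Module.End.eigenspace a (μ : ℂ)).starProjection : complexBetti A.X 1 →L[ℂ] complexBetti A.X 1) :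
        Module.End ℂ (complexBetti A.X 1)) with hPdef
    have hPcomm : ∀ T ∈ symmetricPullbackSpan A h, ∀ x, P (T x) = T (P x) := fun T hT x ↦
      starProjection_eigenspace_comm_of_comm hsa ((Subalgebra.mem_centralizer_iff ℂ).1 haC T hT) μ x
    have hPsym : ∀ x y, polarizationPairingOne A.X h (A.dim - 1) (P x) y =
        polarizationPairingOne A.X h (A.dim - 1) x (P y) :=
      starProjection_eigenspace_symm_of_symm hsa (polarizationPairingOne A.X h (A.dim - 1)) hsym μ
    have hPP : ∀ x, P (P x) = P x := fun x ↦
      starProjection_eigenspace_apply_of_mem (starProjection_eigenspace_apply_mem a _ x)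
    set g : Module.End ℂ (complexBetti A.X 1) := 1 - (2 : ℂ) • P with hgdef
    have hg_apply : ∀ x, g x = x - (2 : ℂ) • P x := fun x ↦ rfl
    have hgg : ∀ x, g (g x) = x := by
      intro x
      rw [hg_apply, hg_apply, map_sub, map_smul, hPP]
      module
    have hgsym : ∀ x y, polarizationPairingOne A.X h (A.dim - 1) (g x) y =
        polarizationPairingOne A.X h (A.dim - 1) x (g y) := by
      intro x y
      rw [hg_apply, hg_apply, map_sub, map_smul, LinearMap.sub_apply, LinearMap.smul_apply, map_sub, map_smul, hPsym]
    have hgcomp : g ∘ₗ g = LinearMap.id := LinearMap.ext hgg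
    set u : complexBetti A.X 1 ≃ₗ[ℂ] complexBetti A.X 1 := LinearEquiv.ofLinear g g hgcomp hgcomp with hudef
    have hucoe : (u : Module.End ℂ (complexBetti A.X 1)) = g := rfl
    have huG : u ∈ divisorLefschetzGroup A h := by
      refine ⟨fun T hT x ↦ ?_, fun x y ↦ ?_⟩
      · change g (T x) = T (g x)
        rw [hg_apply, hg_apply, map_sub, map_smul, hPcomm T hT]
      · change polarizationPairingOne A.X h (A.dim - 1) (g x) (g y) = _
        rw [hgsym, hgg]
    have hgS : g ∈ S := by
      rw [← hucoe]
      exact Algebra.subset_adjoin ⟨u, huG, rfl⟩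
    have hPg : P = (2 : ℂ)⁻¹ • (1 - g) := by
      rw [hgdef, sub_sub_cancel, smul_smul, inv_mul_cancel₀ two_ne_zero, one_smul]
    rw [hPg]
    exact S.smul_mem (S.sub_mem S.one_mem hgS) _
  rw [eq_sum_smul_starProjection_eigenspace hsa]
  exact S.sum_mem fun μ _ ↦ S.smul_mem (hP μ) _

/-- **A `Q_h`-symmetric element `a` of the commutant of `S_λ ⊗ ℂ`, fixed by `θ(c) = C c̄ C⁻¹` (i.e.
`C ā = a C`), lies in the `ℂ`-span of `G_div(X)(ℂ)`.** Such an `a` is self-adjoint for the positive-definite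
hermitian form `⟪x, y⟫ = ℓ(Q_h(y, C x̄))` (§2b), hence `a = ∑ μ P_μ` with spectral projections `P_μ` commuting
with `S_λ ⊗ ℂ` and `Q_h`-symmetric; the reflections `1 - 2P_μ` commute with `S_λ ⊗ ℂ` and preserve `Q_h`, i.e.
lie in `G_div(X)(ℂ)`, and `P_μ = ½(1 - (1 - 2P_μ))`.
[cite: MoonenZarhin1998WeilClasses, §1 (chunk p0002 L68–71)] [cite: Deligne1982HodgeCycles, proof of Thm. 4.8, (b′) p. 33]
(The case `2 ≤ dim A`, kept for the record; `mem_adjoin_divisorLefschetzGroup_of_symm'` is every positive dimension.) -/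
theorem mem_adjoin_divisorLefschetzGroup_of_symm (h2 : 2 ≤ A.dim) (hQ : IsRationalClass h) {s : ℝ} (hs : s ≠ 0)
    (hK : IsKaehlerClass A.dim A.X ((s : ℂ) • h)) (hX : IsSmoothProjective A.dim A.X)
    {a a' : Module.End ℂ (complexBetti A.X 1)}
    (haC : a ∈ Subalgebra.centralizer ℂ (symmetricPullbackSpan A h : Set (Module.End ℂ (complexBetti A.X 1))))
    (hsym : ∀ x y : complexBetti A.X 1,
      polarizationPairingOne A.X h (A.dim - 1) (a x) y = polarizationPairingOne A.X h (A.dim - 1) x (a y))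
    (hconj : ∀ x, conjClass (ComplexPoints A.X) 1 (a x) = a' (conjClass (ComplexPoints A.X) 1 x))
    (hθ : weilOperatorOne hX * a' = a * weilOperatorOne hX) :
    a ∈ Algebra.adjoin ℂ ((fun u : complexBetti A.X 1 ≃ₗ[ℂ] complexBetti A.X 1 ↦
      (u : Module.End ℂ (complexBetti A.X 1))) '' (divisorLefschetzGroup A h : Set (complexBetti A.X 1 ≃ₗ[ℂ] complexBetti A.X 1))) :=
  mem_adjoin_divisorLefschetzGroup_of_symm' (lt_of_lt_of_le Nat.zero_lt_two h2) hQ hs hK hX haC hsym hconj hθ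

end Symm

/-! ### §3.4 Every element of the commutant: `c = c₁ + i c₂` with `θ`-fixed `cⱼ = (symmetric) + (skew)` -/

section Decomposition

variable {c c' : Module.End ℂ (complexBetti A.X 1)}

/-- `S_λ ⊗ ℂ` is stable under complex conjugation (the pull-backs and `Q_h` are real).
[cite: MoonenZarhin1998WeilClasses, §1 (chunk p0002 L56–57)] [cite: VoisinHodgeI2002, §6.1.3 Cor. 6.12] -/
theorem conj_mem_symmetricPullbackSpan (hQ : IsRationalClass h) (hc : c ∈ symmetricPullbackSpan A h)
    (hcc' : ∀ x, conjClass (ComplexPoints A.X) 1 (c x) = c' (conjClass (ComplexPoints A.X) 1 x)) :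
    c' ∈ symmetricPullbackSpan A h :=
  ⟨conj_mem_span_pullbackOne hc.1 hcc', adjoint_conj hQ hcc' hc.2 hcc'⟩

/-- The commutant `C(S_λ ⊗ ℂ)` is stable under complex conjugation. [cite: MoonenZarhin1998WeilClasses, §1 (chunk p0002 L68–71)] -/
theorem conj_mem_centralizer_symmetricPullbackSpan (hQ : IsRationalClass h)
    (hc : c ∈ Subalgebra.centralizer ℂ (symmetricPullbackSpan A h : Set (Module.End ℂ (complexBetti A.X 1))))
    (hcc' : ∀ x, conjClass (ComplexPoints A.X) 1 (c x) = c' (conjClass (ComplexPoints A.X) 1 x)) :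
    c' ∈ Subalgebra.centralizer ℂ (symmetricPullbackSpan A h : Set (Module.End ℂ (complexBetti A.X 1))) := by
  rw [Subalgebra.mem_centralizer_iff] at hc ⊢
  intro T hT
  obtain ⟨T', hTT'⟩ := exists_conj T
  have hT' : T' ∈ symmetricPullbackSpan A h := conj_mem_symmetricPullbackSpan hQ hT hTT'
  have e := hc T' hT'
  refine LinearMap.ext fun y ↦ ?_
  have key : ∀ x, (T * c') (conjClass (ComplexPoints A.X) 1 x) = (c' * T) (conjClass (ComplexPoints A.X) 1 x) := by
    intro x
    rw [← conj_mul (conj_symm hTT') hcc' x, ← conj_mul hcc' (conj_symm hTT') x, e]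
  have := key (conjClass (ComplexPoints A.X) 1 y)
  rwa [conjClass_conjClass] at this

/-- The commutant `C(S_λ ⊗ ℂ)` is stable under the `Q_h`-adjoint (`S_λ ⊗ ℂ` consists of self-adjoint elements).
[cite: MoonenZarhin1998WeilClasses, §1 (chunk p0002 L56–71)] [cite: Milne1999LefschetzClasses, §1 p. 643] -/
theorem adjoint_mem_centralizer_symmetricPullbackSpan
    (hnd : ∀ x : complexBetti A.X 1, (∀ y, polarizationPairingOne A.X h (A.dim - 1) x y = 0) → x = 0)
    (hc : c ∈ Subalgebra.centralizer ℂ (symmetricPullbackSpan A h : Set (Module.End ℂ (complexBetti A.X 1))))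
    (hadj : ∀ x y : complexBetti A.X 1,
      polarizationPairingOne A.X h (A.dim - 1) (c x) y = polarizationPairingOne A.X h (A.dim - 1) x (c' y)) :
    c' ∈ Subalgebra.centralizer ℂ (symmetricPullbackSpan A h : Set (Module.End ℂ (complexBetti A.X 1))) := by
  rw [Subalgebra.mem_centralizer_iff] at hc ⊢
  intro T hT
  refine LinearMap.ext fun y ↦ ?_
  rw [Module.End.mul_apply, Module.End.mul_apply, ← sub_eq_zero]
  refine eq_zero_of_forall_polarizationPairingOne_eq_zero_right hnd _ fun x ↦ ?_
  rw [map_sub, sub_eq_zero, polarizationPairingOne_apply_right_eq_of_adjoint hT.2,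
    ← hadj, ← hadj, ← Module.End.mul_apply, ← hc T hT, Module.End.mul_apply, hT.2]

/-- Ring bookkeeping with `J² = -1`: `J (c' - J c J) = (c - J c' J) J` and `J (c' + J c J) = -((c + J c' J) J)`. [folklore] -/
private theorem weil_theta_aux {R : Type*} [Ring R] {J : R} (hJJ : J * J = -1) (c c' : R) :
    J * (c' - J * c * J) = (c - J * c' * J) * J ∧ J * (c' + J * c * J) = -((c + J * c' * J) * J) := by
  have h1 : J * (J * c * J) = -(c * J) := by
    rw [← mul_assoc J (J * c) J, ← mul_assoc J J c, hJJ, neg_one_mul, neg_mul]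
  have h2 : J * c' * J * J = -(J * c') := by rw [mul_assoc (J * c') J J, hJJ, mul_neg_one]
  constructor
  · rw [mul_sub, sub_mul, h1, h2]; abel
  · rw [mul_add, add_mul, h1, h2]; abel

/-- Ring bookkeeping with `J² = -1`: from `x J = J y` to `J x = y J`. [folklore] -/
private theorem weil_comm_aux {R : Type*} [Ring R] {J x y : R} (hJJ : J * J = -1) (h : x * J = J * y) :
    J * x = y * J := by
  have h1 : J * x * J = -y := by rw [mul_assoc, h, ← mul_assoc, hJJ, neg_one_mul]
  calc J * x = -(J * x * (J * J)) := by rw [hJJ, mul_neg_one, neg_neg]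
    _ = -(J * x * J * J) := by rw [mul_assoc (J * x) J J]
    _ = y * J := by rw [h1, neg_mul, neg_neg]

/-- **`C(S_λ ⊗ ℂ) ⊆` the subalgebra generated by `G_div(X)(ℂ)`** — the heart of the matter. Every `c` in the
commutant splits as `c = c₁ + i c₂` with `cⱼ` fixed by `θ(c) = C c̄ C⁻¹` (`c₁ = ½(c - C c̄ C)`, `c₂ = -(i/2)(c + C c̄ C)`;
`C⁻¹ = -C`); a `θ`-fixed `d` splits as `½(d + d†) + ½(d - d†)`, `Q_h`-symmetric `θ`-fixed plus `Q_h`-skew, and these lie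
in the span by `mem_adjoin_divisorLefschetzGroup_of_symm` (Hodge–Riemann) and `mem_adjoin_divisorLefschetzGroup_of_skew` (Cayley).
[cite: MoonenZarhin1998WeilClasses, §1 Lemma (3) (chunk p0003 L5–6) and the definition of G_div(X) (chunk p0002 L68–71)]
(Every positive dimension — elliptic curves included: Hodge–Riemann in degree one holds in every dimension,
`HodgeRiemannDegreeOneAllDimensions`; the unprimed statement below is the case `2 ≤ dim A`.) -/
theorem centralizer_symmetricPullbackSpan_le_adjoin_divisorLefschetzGroup' (hA : 0 < A.dim) (hQ : IsRationalClass h) {s : ℝ} (hs : s ≠ 0)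
    (hK : IsKaehlerClass A.dim A.X ((s : ℂ) • h)) :
    Subalgebra.centralizer ℂ (symmetricPullbackSpan A h : Set (Module.End ℂ (complexBetti A.X 1))) ≤
      Algebra.adjoin ℂ ((fun u : complexBetti A.X 1 ≃ₗ[ℂ] complexBetti A.X 1 ↦
        (u : Module.End ℂ (complexBetti A.X 1))) '' (divisorLefschetzGroup A h : Set (complexBetti A.X 1 ≃ₗ[ℂ] complexBetti A.X 1))) := by
  intro c hc
  have hA0 : 0 < A.dim := hA
  have hX : IsSmoothProjective A.dim A.X := AbelianVariety.isSmoothProjective_holds (A := A)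
  have hnd := eq_zero_of_forall_polarizationPairingOne_eq_zero_of_isKaehlerClass_smul' hs hK
  set C := Subalgebra.centralizer ℂ (symmetricPullbackSpan A h : Set (Module.End ℂ (complexBetti A.X 1))) with hCdef
  set S := Algebra.adjoin ℂ ((fun u : complexBetti A.X 1 ≃ₗ[ℂ] complexBetti A.X 1 ↦
      (u : Module.End ℂ (complexBetti A.X 1))) '' (divisorLefschetzGroup A h : Set (complexBetti A.X 1 ≃ₗ[ℂ] complexBetti A.X 1)))
    with hSdef
  set J := weilOperatorOne hX with hJdef
  have hJJ : J * J = -1 := weilOperatorOne_mul_weilOperatorOne hX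
  have hJC : J ∈ C := weilOperatorOne_mem_centralizer_symmetricPullbackSpan hX
  have hJadj : ∀ x y : complexBetti A.X 1, polarizationPairingOne A.X h (A.dim - 1) (J x) y =
      polarizationPairingOne A.X h (A.dim - 1) x ((-J) y) :=
    polarizationPairingOne_weilOperatorOne_left hX hs hK hA0
  have hJconj : ∀ x, conjClass (ComplexPoints A.X) 1 (J x) = J (conjClass (ComplexPoints A.X) 1 x) :=
    conj_weilOperatorOne hX
  -- `θ`-fixed elements of `C` lie in `S`
  have hθfixed : ∀ d d' : Module.End ℂ (complexBetti A.X 1), d ∈ C →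
      (∀ x, conjClass (ComplexPoints A.X) 1 (d x) = d' (conjClass (ComplexPoints A.X) 1 x)) →
      J * d' = d * J → d ∈ S := by
    intro d d' hdC hdd' hθd
    obtain ⟨e, he⟩ := exists_adjoint_polarizationPairingOne hnd d
    have he' := adjoint_adjoint_polarizationPairingOne he
    have heC : e ∈ C := adjoint_mem_centralizer_symmetricPullbackSpan hnd hdC he
    obtain ⟨e', hee'⟩ := exists_conj e
    -- `e'` is the adjoint of `d'`, and `J e' = e J`
    have hd'e' : ∀ x y : complexBetti A.X 1, polarizationPairingOne A.X h (A.dim - 1) (d' x) y =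
        polarizationPairingOne A.X h (A.dim - 1) x (e' y) := adjoint_conj hQ hdd' he hee'
    have hJe' : J * e' = e * J := by
      refine weil_comm_aux hJJ ?_
      have h1 := adjoint_mul_polarizationPairingOne (h := h) hJadj hd'e'
      have h2 := adjoint_mul_polarizationPairingOne (h := h) he hJadj
      rw [hθd] at h1
      have e3 := adjoint_unique_polarizationPairingOne hnd h1 h2
      rw [mul_neg, neg_mul, neg_inj] at e3
      exact e3
    -- the symmetric and skew parts
    set a := (2 : ℂ)⁻¹ • (d + e) with hadef
    set k := (2 : ℂ)⁻¹ • (d - e) with hkdef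
    have hdak : d = a + k := by rw [hadef, hkdef]; module
    have haC : a ∈ C := C.smul_mem (C.add_mem hdC heC) _
    have hkC : k ∈ C := C.smul_mem (C.sub_mem hdC heC) _
    have hasym : ∀ x y : complexBetti A.X 1, polarizationPairingOne A.X h (A.dim - 1) (a x) y =
        polarizationPairingOne A.X h (A.dim - 1) x (a y) := by
      intro x y
      simp only [hadef, LinearMap.smul_apply, LinearMap.add_apply, map_add, map_smul, LinearMap.add_apply,
        LinearMap.smul_apply, he, he']
      rw [add_comm (polarizationPairingOne A.X h (A.dim - 1) x (e y))]
    have hkskew : ∀ x y : complexBetti A.X 1, polarizationPairingOne A.X h (A.dim - 1) (k x) y =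
        -polarizationPairingOne A.X h (A.dim - 1) x (k y) := by
      intro x y
      simp only [hkdef, LinearMap.smul_apply, LinearMap.sub_apply, map_sub, map_smul, LinearMap.sub_apply,
        LinearMap.smul_apply, he, he', smul_sub, neg_sub]
    -- the conjugate of `a` and its `θ`-fixedness
    set a' := (2 : ℂ)⁻¹ • (d' + e') with ha'def
    have haa' : ∀ x, conjClass (ComplexPoints A.X) 1 (a x) = a' (conjClass (ComplexPoints A.X) 1 x) := by
      intro x
      simp only [hadef, ha'def, LinearMap.smul_apply, LinearMap.add_apply, conjClass_smul, conjClass_add, hdd', hee',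
        map_inv₀, map_ofNat]
    have hθa : J * a' = a * J := by
      rw [ha'def, hadef, mul_smul_comm, mul_add, hθd, hJe', ← add_mul, smul_mul_assoc]
    rw [hdak]
    exact S.add_mem (mem_adjoin_divisorLefschetzGroup_of_symm' hA hQ hs hK hX haC hasym haa' hθa) (mem_adjoin_divisorLefschetzGroup_of_skew hkC hkskew)
  -- the decomposition `c = c₁ + i c₂`
  obtain ⟨c', hcc'⟩ := exists_conj c
  have hc'C : c' ∈ C := conj_mem_centralizer_symmetricPullbackSpan hQ hc hcc'
  set c₁ := (2 : ℂ)⁻¹ • (c - J * c' * J) with hc₁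
  set c₂ := (-(Complex.I / 2)) • (c + J * c' * J) with hc₂
  have hI2 : Complex.I * -(Complex.I / 2) = (2 : ℂ)⁻¹ := by
    rw [mul_neg, ← mul_div_assoc, Complex.I_mul_I]; norm_num
  have hcdec : c = c₁ + Complex.I • c₂ := by
    rw [hc₁, hc₂, smul_smul, hI2, ← smul_add]
    rw [show c - J * c' * J + (c + J * c' * J) = (2 : ℂ) • c by rw [two_smul]; abel, smul_smul,
      inv_mul_cancel₀ two_ne_zero, one_smul]
  have hJcJ : J * c' * J ∈ C := C.mul_mem (C.mul_mem hJC hc'C) hJC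
  have hc₁C : c₁ ∈ C := C.smul_mem (C.sub_mem hc hJcJ) _
  have hc₂C : c₂ ∈ C := C.smul_mem (C.add_mem hc hJcJ) _
  -- conjugates of `c₁`, `c₂`
  have hJc'J : ∀ x, conjClass (ComplexPoints A.X) 1 ((J * c' * J) x) = (J * c * J) (conjClass (ComplexPoints A.X) 1 x) :=
    conj_mul (conj_mul hJconj (conj_symm hcc')) hJconj
  set c₁' := (2 : ℂ)⁻¹ • (c' - J * c * J) with hc₁'
  set c₂' := (Complex.I / 2) • (c' + J * c * J) with hc₂'
  have hc₁c : ∀ x, conjClass (ComplexPoints A.X) 1 (c₁ x) = c₁' (conjClass (ComplexPoints A.X) 1 x) := by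
    intro x
    rw [hc₁, hc₁', LinearMap.smul_apply, LinearMap.smul_apply, conjClass_smul, LinearMap.sub_apply,
      LinearMap.sub_apply, conjClass_sub, hcc', hJc'J, map_inv₀, map_ofNat]
  have hc₂c : ∀ x, conjClass (ComplexPoints A.X) 1 (c₂ x) = c₂' (conjClass (ComplexPoints A.X) 1 x) := by
    intro x
    rw [hc₂, hc₂', LinearMap.smul_apply, LinearMap.smul_apply, conjClass_smul, LinearMap.add_apply,
      LinearMap.add_apply, conjClass_add, hcc', hJc'J, map_neg, map_div₀, Complex.conj_I, map_ofNat, neg_div,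
      neg_neg]
  obtain ⟨hθ1, hθ2⟩ := weil_theta_aux hJJ c c'
  have hθc₁ : J * c₁' = c₁ * J := by
    rw [hc₁', hc₁, mul_smul_comm, smul_mul_assoc, hθ1]
  have hθc₂ : J * c₂' = c₂ * J := by
    rw [hc₂', hc₂, mul_smul_comm, smul_mul_assoc, hθ2, smul_neg, ← neg_smul]
  rw [hcdec]
  exact S.add_mem (hθfixed c₁ c₁' hc₁C hc₁c hθc₁) (S.smul_mem (hθfixed c₂ c₂' hc₂C hc₂c hθc₂) _)

/-- **`C(S_λ ⊗ ℂ) ⊆` the subalgebra generated by `G_div(X)(ℂ)`** — the heart of the matter. Every `c` in the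
commutant splits as `c = c₁ + i c₂` with `cⱼ` fixed by `θ(c) = C c̄ C⁻¹` (`c₁ = ½(c - C c̄ C)`, `c₂ = -(i/2)(c + C c̄ C)`;
`C⁻¹ = -C`); a `θ`-fixed `d` splits as `½(d + d†) + ½(d - d†)`, `Q_h`-symmetric `θ`-fixed plus `Q_h`-skew, and these lie
in the span by `mem_adjoin_divisorLefschetzGroup_of_symm` (Hodge–Riemann) and `mem_adjoin_divisorLefschetzGroup_of_skew` (Cayley).
[cite: MoonenZarhin1998WeilClasses, §1 Lemma (3) (chunk p0003 L5–6) and the definition of G_div(X) (chunk p0002 L68–71)]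
(The case `2 ≤ dim A`, kept for the record; `centralizer_symmetricPullbackSpan_le_adjoin_divisorLefschetzGroup'` is every positive dimension.) -/
theorem centralizer_symmetricPullbackSpan_le_adjoin_divisorLefschetzGroup (h2 : 2 ≤ A.dim) (hQ : IsRationalClass h) {s : ℝ} (hs : s ≠ 0)
    (hK : IsKaehlerClass A.dim A.X ((s : ℂ) • h)) :
    Subalgebra.centralizer ℂ (symmetricPullbackSpan A h : Set (Module.End ℂ (complexBetti A.X 1))) ≤
      Algebra.adjoin ℂ ((fun u : complexBetti A.X 1 ≃ₗ[ℂ] complexBetti A.X 1 ↦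
        (u : Module.End ℂ (complexBetti A.X 1))) '' (divisorLefschetzGroup A h : Set (complexBetti A.X 1 ≃ₗ[ℂ] complexBetti A.X 1))) :=
  centralizer_symmetricPullbackSpan_le_adjoin_divisorLefschetzGroup' (lt_of_lt_of_le Nat.zero_lt_two h2) hQ hs hK

end Decomposition

end DivisorLefschetzGroup

open DivisorLefschetzGroup

variable {A : AbelianVariety ℂ} {h : complexBetti A.X 2}

/-! ## §4 The span of `G_div(X)(ℂ)`; `B ⊗ ℂ` acts semisimply; the double commutant; Lemma (3) and Lemma (1) -/

section Main

/-- The subalgebra generated by `G_div(X)(ℂ)` lies in the commutant `C(S_λ ⊗ ℂ)` (every element of `G_div(X)(ℂ)`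
commutes with `S_λ ⊗ ℂ`). [cite: MoonenZarhin1998WeilClasses, §1 (chunk p0002 L68–71)] -/
theorem adjoin_divisorLefschetzGroup_le_centralizer :
    Algebra.adjoin ℂ ((fun u : complexBetti A.X 1 ≃ₗ[ℂ] complexBetti A.X 1 ↦
        (u : Module.End ℂ (complexBetti A.X 1))) '' (divisorLefschetzGroup A h : Set (complexBetti A.X 1 ≃ₗ[ℂ] complexBetti A.X 1))) ≤
      Subalgebra.centralizer ℂ (symmetricPullbackSpan A h : Set (Module.End ℂ (complexBetti A.X 1))) := by
  refine Algebra.adjoin_le ?_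
  rintro _ ⟨u, hu, rfl⟩
  rw [SetLike.mem_coe, Subalgebra.mem_centralizer_iff]
  intro T hT
  exact LinearMap.ext fun x ↦ ((mem_divisorLefschetzGroup_iff.1 hu).1 T hT x).symm

/-- **`G_div(X)(ℂ)` spans `Gl_B(V) ⊗ ℂ`: the `ℂ`-subalgebra of `End(H¹(A(ℂ); ℂ))` generated by
`G_div(X)(ℂ) = Gl_B(V) ∩ Sp(V, φ)` (`ℂ`-points) IS the commutant `C(S_λ ⊗ ℂ) = End_{B ⊗ ℂ}(V ⊗ ℂ)`**, for every complex
abelian variety of positive dimension and every polarization class `h` (rational, `s · h` Kähler, `s ≠ 0`). This is the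
carrier form of «`G_div` is Zariski-dense enough in `Gl_B(V)`» behind Lemma (3); road: Cayley transform for the
skew part, Hodge–Riemann in degree one for the symmetric part (`centralizer_symmetricPullbackSpan_le_adjoin_divisorLefschetzGroup`).
[cite: MoonenZarhin1998WeilClasses, §1 (chunk p0002 L68–71) and Lemma (3) (chunk p0003 L5–9)]
(Every positive dimension — elliptic curves included: Hodge–Riemann in degree one holds in every dimension,
`HodgeRiemannDegreeOneAllDimensions`; the unprimed statement below is the case `2 ≤ dim A`.) -/
theorem adjoin_divisorLefschetzGroup_eq_centralizer' (hA : 0 < A.dim) (hQ : IsRationalClass h) {s : ℝ} (hs : s ≠ 0)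
    (hK : IsKaehlerClass A.dim A.X ((s : ℂ) • h)) :
    Algebra.adjoin ℂ ((fun u : complexBetti A.X 1 ≃ₗ[ℂ] complexBetti A.X 1 ↦
        (u : Module.End ℂ (complexBetti A.X 1))) '' (divisorLefschetzGroup A h : Set (complexBetti A.X 1 ≃ₗ[ℂ] complexBetti A.X 1))) =
      Subalgebra.centralizer ℂ (symmetricPullbackSpan A h : Set (Module.End ℂ (complexBetti A.X 1))) :=
  le_antisymm adjoin_divisorLefschetzGroup_le_centralizer (centralizer_symmetricPullbackSpan_le_adjoin_divisorLefschetzGroup' hA hQ hs hK)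

/-- **`G_div(X)(ℂ)` spans `Gl_B(V) ⊗ ℂ`: the `ℂ`-subalgebra of `End(H¹(A(ℂ); ℂ))` generated by
`G_div(X)(ℂ) = Gl_B(V) ∩ Sp(V, φ)` (`ℂ`-points) IS the commutant `C(S_λ ⊗ ℂ) = End_{B ⊗ ℂ}(V ⊗ ℂ)`**, for every complex
abelian variety of dimension `≥ 2` and every polarization class `h` (rational, `s · h` Kähler, `s ≠ 0`). This is the
carrier form of «`G_div` is Zariski-dense enough in `Gl_B(V)`» behind Lemma (3); road: Cayley transform for the
skew part, Hodge–Riemann in degree one for the symmetric part (`centralizer_symmetricPullbackSpan_le_adjoin_divisorLefschetzGroup`).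
[cite: MoonenZarhin1998WeilClasses, §1 (chunk p0002 L68–71) and Lemma (3) (chunk p0003 L5–9)]
(The case `2 ≤ dim A`, kept for the record; `adjoin_divisorLefschetzGroup_eq_centralizer'` is every positive dimension.) -/
theorem adjoin_divisorLefschetzGroup_eq_centralizer (h2 : 2 ≤ A.dim) (hQ : IsRationalClass h) {s : ℝ} (hs : s ≠ 0)
    (hK : IsKaehlerClass A.dim A.X ((s : ℂ) • h)) :
    Algebra.adjoin ℂ ((fun u : complexBetti A.X 1 ≃ₗ[ℂ] complexBetti A.X 1 ↦
        (u : Module.End ℂ (complexBetti A.X 1))) '' (divisorLefschetzGroup A h : Set (complexBetti A.X 1 ≃ₗ[ℂ] complexBetti A.X 1))) =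
      Subalgebra.centralizer ℂ (symmetricPullbackSpan A h : Set (Module.End ℂ (complexBetti A.X 1))) :=
  adjoin_divisorLefschetzGroup_eq_centralizer' (lt_of_lt_of_le Nat.zero_lt_two h2) hQ hs hK

variable {b b' : Module.End ℂ (complexBetti A.X 1)}

/-- `B ⊗ ℂ` (the subalgebra generated by `S_λ ⊗ ℂ`) is stable under the `Q_h`-adjoint («`B` … the `ℚ`-subalgebra
generated by `S_λ`», the set of `†`-symmetric elements; `†` is an anti-automorphism).
[cite: MoonenZarhin1998WeilClasses, §1 (chunk p0002 L56–57)] [cite: Milne1999LefschetzClasses, §1 p. 642] -/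
theorem adjoint_mem_adjoin_symmetricPullbackSpan
    (hnd : ∀ x : complexBetti A.X 1, (∀ y, polarizationPairingOne A.X h (A.dim - 1) x y = 0) → x = 0)
    (hb : b ∈ Algebra.adjoin ℂ (symmetricPullbackSpan A h : Set (Module.End ℂ (complexBetti A.X 1))))
    (hadj : ∀ x y : complexBetti A.X 1,
      polarizationPairingOne A.X h (A.dim - 1) (b x) y = polarizationPairingOne A.X h (A.dim - 1) x (b' y)) :
    b' ∈ Algebra.adjoin ℂ (symmetricPullbackSpan A h : Set (Module.End ℂ (complexBetti A.X 1))) := by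
  suffices H : ∀ e ∈ Algebra.adjoin ℂ (symmetricPullbackSpan A h : Set (Module.End ℂ (complexBetti A.X 1))),
      ∃ e' ∈ Algebra.adjoin ℂ (symmetricPullbackSpan A h : Set (Module.End ℂ (complexBetti A.X 1))),
        ∀ x y : complexBetti A.X 1,
          polarizationPairingOne A.X h (A.dim - 1) (e x) y = polarizationPairingOne A.X h (A.dim - 1) x (e' y) by
    obtain ⟨e', he', hbe'⟩ := H b hb
    rwa [adjoint_unique_polarizationPairingOne hnd hadj hbe']
  intro e he
  induction he using Algebra.adjoin_induction with
  | mem e he => exact ⟨e, Algebra.subset_adjoin he, he.2⟩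
  | algebraMap r =>
    refine ⟨algebraMap ℂ _ r, Subalgebra.algebraMap_mem _ r, fun x y ↦ ?_⟩
    rw [Algebra.algebraMap_eq_smul_one, LinearMap.smul_apply, LinearMap.smul_apply, Module.End.one_apply,
      Module.End.one_apply, map_smul, LinearMap.smul_apply, map_smul]
  | add e f _ _ he hf =>
    obtain ⟨e', he', hee'⟩ := he
    obtain ⟨f', hf', hff'⟩ := hf
    exact ⟨e' + f', Subalgebra.add_mem _ he' hf', adjoint_add hee' hff'⟩
  | mul e f _ _ he hf =>
    obtain ⟨e', he', hee'⟩ := he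
    obtain ⟨f', hf', hff'⟩ := hf
    exact ⟨f' * e', Subalgebra.mul_mem _ hf' he', adjoint_mul_polarizationPairingOne hee' hff'⟩

/-- `B ⊗ ℂ` is stable under complex conjugation. [cite: MoonenZarhin1998WeilClasses, §1 (chunk p0002 L56–57)]
[cite: VoisinHodgeI2002, §6.1.3 Cor. 6.12] -/
theorem conj_mem_adjoin_symmetricPullbackSpan (hQ : IsRationalClass h)
    (hb : b ∈ Algebra.adjoin ℂ (symmetricPullbackSpan A h : Set (Module.End ℂ (complexBetti A.X 1))))
    (hbb' : ∀ x, conjClass (ComplexPoints A.X) 1 (b x) = b' (conjClass (ComplexPoints A.X) 1 x)) :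
    b' ∈ Algebra.adjoin ℂ (symmetricPullbackSpan A h : Set (Module.End ℂ (complexBetti A.X 1))) := by
  suffices H : ∀ e ∈ Algebra.adjoin ℂ (symmetricPullbackSpan A h : Set (Module.End ℂ (complexBetti A.X 1))),
      ∃ e' ∈ Algebra.adjoin ℂ (symmetricPullbackSpan A h : Set (Module.End ℂ (complexBetti A.X 1))),
        ∀ x, conjClass (ComplexPoints A.X) 1 (e x) = e' (conjClass (ComplexPoints A.X) 1 x) by
    obtain ⟨e', he', hbe'⟩ := H b hb
    rwa [conj_unique hbb' hbe']
  intro e he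
  induction he using Algebra.adjoin_induction with
  | mem e he =>
    obtain ⟨e', hee'⟩ := exists_conj e
    exact ⟨e', Algebra.subset_adjoin (conj_mem_symmetricPullbackSpan hQ he hee'), hee'⟩
  | algebraMap r =>
    refine ⟨algebraMap ℂ _ (starRingEnd ℂ r), Subalgebra.algebraMap_mem _ _, fun x ↦ ?_⟩
    rw [Algebra.algebraMap_eq_smul_one, Algebra.algebraMap_eq_smul_one, LinearMap.smul_apply, LinearMap.smul_apply,
      Module.End.one_apply, Module.End.one_apply, conjClass_smul]
  | add e f _ _ he hf =>
    obtain ⟨e', he', hee'⟩ := he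
    obtain ⟨f', hf', hff'⟩ := hf
    exact ⟨e' + f', Subalgebra.add_mem _ he' hf', conj_add hee' hff'⟩
  | mul e f _ _ he hf =>
    obtain ⟨e', he', hee'⟩ := he
    obtain ⟨f', hf', hff'⟩ := hf
    exact ⟨e' * f', Subalgebra.mul_mem _ he' hf', conj_mul hee' hff'⟩

/-- The Weil operator commutes with `B ⊗ ℂ`. [cite: VoisinHodgeI2002, §7.3.2] -/
theorem weilOperatorOne_comm_of_mem_adjoin (hX : IsSmoothProjective A.dim A.X)
    (hb : b ∈ Algebra.adjoin ℂ (symmetricPullbackSpan A h : Set (Module.End ℂ (complexBetti A.X 1)))) :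
    weilOperatorOne hX * b = b * weilOperatorOne hX := by
  have hb' := Algebra.adjoin_le_centralizer_centralizer ℂ _ hb
  rw [Subalgebra.mem_centralizer_iff] at hb'
  exact hb' _ (weilOperatorOne_mem_centralizer_symmetricPullbackSpan hX)

/-- **`H¹(A(ℂ); ℂ)` is a semisimple `B ⊗ ℂ`-module** (for `0 < dim A` and a polarization class `h`): `B ⊗ ℂ` is closed
under adjoints for the positive-definite hermitian form `⟪x, y⟫ = ℓ(Q_h(y, C x̄))` — the adjoint of `b` is
`\overline{b†}` — so orthogonal complements of `B ⊗ ℂ`-submodules are `B ⊗ ℂ`-submodules. (The print: `B` is a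
semisimple `ℚ`-algebra, being stable under the positive Rosati involution of `End⁰(X)`.)
[cite: MoonenZarhin1998WeilClasses, §1 (chunk p0002 L56–57) and Table 1] [cite: BourbakiAlgebreVIII2012, §5 n°4]
(Every positive dimension — elliptic curves included: Hodge–Riemann in degree one holds in every dimension,
`HodgeRiemannDegreeOneAllDimensions`; the unprimed statement below is the case `2 ≤ dim A`.) -/
theorem isSemisimpleModule_adjoin_symmetricPullbackSpan' (hA : 0 < A.dim) (hQ : IsRationalClass h) {s : ℝ} (hs : s ≠ 0)
    (hK : IsKaehlerClass A.dim A.X ((s : ℂ) • h)) :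
    IsSemisimpleModule (Algebra.adjoin ℂ (symmetricPullbackSpan A h : Set (Module.End ℂ (complexBetti A.X 1))))
      (complexBetti A.X 1) := by
  haveI hfin : Module.Finite ℂ (complexBetti A.X 1) := abelianVarietyCohomologyExteriorH1_holds.finite_one A
  have hA0 : 0 < A.dim := hA
  have hX : IsSmoothProjective A.dim A.X := AbelianVariety.isSmoothProjective_holds (A := A)
  have hnd := eq_zero_of_forall_polarizationPairingOne_eq_zero_of_isKaehlerClass_smul' hs hK
  obtain ⟨ℓ, core, hℓinj, hℓconj, hinner⟩ := exists_innerProductSpaceCore' hA hQ hs hK hX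
  letI : NormedAddCommGroup (complexBetti A.X 1) := @InnerProductSpace.Core.toNormedAddCommGroup ℂ _ _ _ _ core
  letI : InnerProductSpace ℂ (complexBetti A.X 1) := InnerProductSpace.ofCore _
  haveI : FiniteDimensional ℂ (complexBetti A.X 1) := hfin
  refine isSemisimpleModule_of_adjoint_mem _ fun r hr ↦ ?_
  -- the adjoint of `r` for `⟪·, ·⟫` is the conjugate of its `Q_h`-adjoint
  obtain ⟨r', hrr'⟩ := exists_adjoint_polarizationPairingOne hnd r
  have hr' := adjoint_mem_adjoin_symmetricPullbackSpan hnd hr hrr'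
  obtain ⟨w, hw⟩ := exists_conj r'
  have hwmem := conj_mem_adjoin_symmetricPullbackSpan hQ hr' hw
  have hJr' : weilOperatorOne hX * r' = r' * weilOperatorOne hX := weilOperatorOne_comm_of_mem_adjoin hX hr'
  have hadj : LinearMap.adjoint r = w := by
    symm
    rw [LinearMap.eq_adjoint_iff]
    intro x y
    change @inner ℂ _ core.toInner (w x) y = @inner ℂ _ core.toInner x (r y)
    rw [hinner, hinner, conj_symm hw x, ← Module.End.mul_apply, hJr', Module.End.mul_apply, ← hrr']
  rw [hadj]
  exact hwmem

/-- **`H¹(A(ℂ); ℂ)` is a semisimple `B ⊗ ℂ`-module** (for `dim A ≥ 2` and a polarization class `h`): `B ⊗ ℂ` is closed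
under adjoints for the positive-definite hermitian form `⟪x, y⟫ = ℓ(Q_h(y, C x̄))` — the adjoint of `b` is
`\overline{b†}` — so orthogonal complements of `B ⊗ ℂ`-submodules are `B ⊗ ℂ`-submodules. (The print: `B` is a
semisimple `ℚ`-algebra, being stable under the positive Rosati involution of `End⁰(X)`.)
[cite: MoonenZarhin1998WeilClasses, §1 (chunk p0002 L56–57) and Table 1] [cite: BourbakiAlgebreVIII2012, §5 n°4]
(The case `2 ≤ dim A`, kept for the record; `isSemisimpleModule_adjoin_symmetricPullbackSpan'` is every positive dimension.) -/
theorem isSemisimpleModule_adjoin_symmetricPullbackSpan (h2 : 2 ≤ A.dim) (hQ : IsRationalClass h) {s : ℝ} (hs : s ≠ 0)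
    (hK : IsKaehlerClass A.dim A.X ((s : ℂ) • h)) :
    IsSemisimpleModule (Algebra.adjoin ℂ (symmetricPullbackSpan A h : Set (Module.End ℂ (complexBetti A.X 1))))
      (complexBetti A.X 1) :=
  isSemisimpleModule_adjoin_symmetricPullbackSpan' (lt_of_lt_of_le Nat.zero_lt_two h2) hQ hs hK

/-- Commuting with `S_λ ⊗ ℂ` is commuting with the algebra `B ⊗ ℂ` it generates: the two commutants agree.
[cite: MoonenZarhin1998WeilClasses, §1 (chunk p0002 L68–71)] -/
theorem centralizer_symmetricPullbackSpan_eq_centralizer_adjoin :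
    Subalgebra.centralizer ℂ (symmetricPullbackSpan A h : Set (Module.End ℂ (complexBetti A.X 1))) =
      Subalgebra.centralizer ℂ ((Algebra.adjoin ℂ
        (symmetricPullbackSpan A h : Set (Module.End ℂ (complexBetti A.X 1))) :
          Subalgebra ℂ (Module.End ℂ (complexBetti A.X 1))) : Set (Module.End ℂ (complexBetti A.X 1))) := by
  refine le_antisymm (fun z hz ↦ ?_)
    (Subalgebra.centralizer_le ℂ (symmetricPullbackSpan A h : Set (Module.End ℂ (complexBetti A.X 1))) _
      Algebra.subset_adjoin)
  rw [Subalgebra.mem_centralizer_iff] at hz ⊢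
  intro b hb
  induction hb using Algebra.adjoin_induction with
  | mem e he => exact hz e he
  | algebraMap r => exact Algebra.commutes r z
  | add e f _ _ he hf => rw [add_mul, mul_add, he, hf]
  | mul e f _ _ he hf => rw [mul_assoc, hf, ← mul_assoc, he, mul_assoc]

/-- **`B ⊗ ℂ` is its own bicommutant in `End(H¹(A(ℂ); ℂ))`** (double commutant theorem for the semisimple
`B ⊗ ℂ`-module `H¹(A(ℂ); ℂ)`), for `0 < dim A` and a polarization class `h`.
[cite: BourbakiAlgebreVIII2012, §5 n°4 (bicommutant d'un module semi-simple)] [cite: MoonenZarhin1998WeilClasses, §1 Lemma (3) (chunk p0003 L5–9)]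
(Every positive dimension — elliptic curves included: Hodge–Riemann in degree one holds in every dimension,
`HodgeRiemannDegreeOneAllDimensions`; the unprimed statement below is the case `2 ≤ dim A`.) -/
theorem centralizer_centralizer_adjoin_symmetricPullbackSpan' (hA : 0 < A.dim) (hQ : IsRationalClass h) {s : ℝ}
    (hs : s ≠ 0) (hK : IsKaehlerClass A.dim A.X ((s : ℂ) • h)) :
    Subalgebra.centralizer ℂ ((Subalgebra.centralizer ℂ ((Algebra.adjoin ℂ
        (symmetricPullbackSpan A h : Set (Module.End ℂ (complexBetti A.X 1))) :
          Subalgebra ℂ (Module.End ℂ (complexBetti A.X 1))) : Set (Module.End ℂ (complexBetti A.X 1)))) :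
        Set (Module.End ℂ (complexBetti A.X 1))) =
      Algebra.adjoin ℂ (symmetricPullbackSpan A h : Set (Module.End ℂ (complexBetti A.X 1))) := by
  haveI : Module.Finite ℂ (complexBetti A.X 1) := abelianVarietyCohomologyExteriorH1_holds.finite_one A
  haveI := isSemisimpleModule_adjoin_symmetricPullbackSpan' hA hQ hs hK
  exact Literature.LinearAlgebra.Matrix.centralizer_centralizer_eq_of_isSemisimpleModule _

/-- **`B ⊗ ℂ` is its own bicommutant in `End(H¹(A(ℂ); ℂ))`** (double commutant theorem for the semisimple
`B ⊗ ℂ`-module `H¹(A(ℂ); ℂ)`), for `dim A ≥ 2` and a polarization class `h`.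
[cite: BourbakiAlgebreVIII2012, §5 n°4 (bicommutant d'un module semi-simple)] [cite: MoonenZarhin1998WeilClasses, §1 Lemma (3) (chunk p0003 L5–9)]
(The case `2 ≤ dim A`, kept for the record; `centralizer_centralizer_adjoin_symmetricPullbackSpan'` is every positive dimension.) -/
theorem centralizer_centralizer_adjoin_symmetricPullbackSpan (h2 : 2 ≤ A.dim) (hQ : IsRationalClass h) {s : ℝ}
    (hs : s ≠ 0) (hK : IsKaehlerClass A.dim A.X ((s : ℂ) • h)) :
    Subalgebra.centralizer ℂ ((Subalgebra.centralizer ℂ ((Algebra.adjoin ℂ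
        (symmetricPullbackSpan A h : Set (Module.End ℂ (complexBetti A.X 1))) :
          Subalgebra ℂ (Module.End ℂ (complexBetti A.X 1))) : Set (Module.End ℂ (complexBetti A.X 1)))) :
        Set (Module.End ℂ (complexBetti A.X 1))) =
      Algebra.adjoin ℂ (symmetricPullbackSpan A h : Set (Module.End ℂ (complexBetti A.X 1))) :=
  centralizer_centralizer_adjoin_symmetricPullbackSpan' (lt_of_lt_of_le Nat.zero_lt_two h2) hQ hs hK

/-- **Moonen–Zarhin 1998, §1 Lemma (3), first clause «`End(V_X)^{G_div(X)} = B`», `⊗ ℂ`, UNCONDITIONALLY** — for every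
complex abelian variety `A` of positive dimension and every polarization class `h` (rational, `s · h` Kähler, `s ≠ 0`): an
endomorphism `T` of `H¹(A(ℂ); ℂ)` commutes with every element of `G_div(X)(h)(ℂ) = divisorLefschetzGroup A h` iff `T`
lies in `B ⊗ ℂ = Algebra.adjoin ℂ (S_λ ⊗ ℂ)`. (`⇒`: `T` commutes with the algebra generated by `G_div(X)(ℂ)`, which is
the whole commutant of `B ⊗ ℂ` (`adjoin_divisorLefschetzGroup_eq_centralizer`), so `T` is in the bicommutant of
`B ⊗ ℂ`, `= B ⊗ ℂ` (`centralizer_centralizer_adjoin_symmetricPullbackSpan`); `⇐`: `G_div` centralizes `B`.) The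
print derives this from Table 2 and classical invariant theory ([Kum1]); this road is classification-free.
[cite: MoonenZarhin1998WeilClasses, §1 Lemma (3) (chunk p0003 L5–9)]
(Every positive dimension — elliptic curves included: Hodge–Riemann in degree one holds in every dimension,
`HodgeRiemannDegreeOneAllDimensions`; the unprimed statement below is the case `2 ≤ dim A`.) -/
theorem forall_mem_divisorLefschetzGroup_comm_iff_mem_adjoin_of_isKaehlerClass' (hA : 0 < A.dim)
    (hQ : IsRationalClass h) {s : ℝ} (hs : s ≠ 0) (hK : IsKaehlerClass A.dim A.X ((s : ℂ) • h))
    {T : Module.End ℂ (complexBetti A.X 1)} :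
    (∀ u ∈ divisorLefschetzGroup A h, ∀ y : complexBetti A.X 1, T (u y) = u (T y)) ↔
      T ∈ Algebra.adjoin ℂ (symmetricPullbackSpan A h : Set (Module.End ℂ (complexBetti A.X 1))) := by
  constructor
  · intro hT
    rw [← centralizer_centralizer_adjoin_symmetricPullbackSpan' hA hQ hs hK,
      ← centralizer_symmetricPullbackSpan_eq_centralizer_adjoin, ← adjoin_divisorLefschetzGroup_eq_centralizer' hA hQ hs hK,
      Subalgebra.mem_centralizer_iff]
    intro c hc
    induction hc using Algebra.adjoin_induction with
    | mem g hg =>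
      obtain ⟨u, hu, rfl⟩ := hg
      exact LinearMap.ext fun y ↦ (hT u hu y).symm
    | algebraMap r => exact Algebra.commutes r T
    | add e f _ _ he hf => rw [add_mul, mul_add, he, hf]
    | mul e f _ _ he hf => rw [mul_assoc, hf, ← mul_assoc, he, mul_assoc]
  · intro hT u hu y
    exact (divisorLefschetzGroup_comm_of_mem_adjoin hu hT y).symm

/-- **Moonen–Zarhin 1998, §1 Lemma (3), first clause «`End(V_X)^{G_div(X)} = B`», `⊗ ℂ`, UNCONDITIONALLY** — for every
complex abelian variety `A` of dimension `≥ 2` and every polarization class `h` (rational, `s · h` Kähler, `s ≠ 0`): an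
endomorphism `T` of `H¹(A(ℂ); ℂ)` commutes with every element of `G_div(X)(h)(ℂ) = divisorLefschetzGroup A h` iff `T`
lies in `B ⊗ ℂ = Algebra.adjoin ℂ (S_λ ⊗ ℂ)`. (`⇒`: `T` commutes with the algebra generated by `G_div(X)(ℂ)`, which is
the whole commutant of `B ⊗ ℂ` (`adjoin_divisorLefschetzGroup_eq_centralizer`), so `T` is in the bicommutant of
`B ⊗ ℂ`, `= B ⊗ ℂ` (`centralizer_centralizer_adjoin_symmetricPullbackSpan`); `⇐`: `G_div` centralizes `B`.) The
print derives this from Table 2 and classical invariant theory ([Kum1]); this road is classification-free.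
[cite: MoonenZarhin1998WeilClasses, §1 Lemma (3) (chunk p0003 L5–9)]
(The case `2 ≤ dim A`, kept for the record; `forall_mem_divisorLefschetzGroup_comm_iff_mem_adjoin_of_isKaehlerClass'` is every positive dimension.) -/
theorem forall_mem_divisorLefschetzGroup_comm_iff_mem_adjoin_of_isKaehlerClass (h2 : 2 ≤ A.dim)
    (hQ : IsRationalClass h) {s : ℝ} (hs : s ≠ 0) (hK : IsKaehlerClass A.dim A.X ((s : ℂ) • h))
    {T : Module.End ℂ (complexBetti A.X 1)} :
    (∀ u ∈ divisorLefschetzGroup A h, ∀ y : complexBetti A.X 1, T (u y) = u (T y)) ↔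
      T ∈ Algebra.adjoin ℂ (symmetricPullbackSpan A h : Set (Module.End ℂ (complexBetti A.X 1))) :=
  forall_mem_divisorLefschetzGroup_comm_iff_mem_adjoin_of_isKaehlerClass' (lt_of_lt_of_le Nat.zero_lt_two h2) hQ hs hK

/-- **Lemma (3), first clause, as an equality of sets: `End(H¹(A(ℂ); ℂ))^{G_div(X)(ℂ)} = B ⊗ ℂ`**, unconditionally
(`0 < dim A`, `h` a polarization class). [cite: MoonenZarhin1998WeilClasses, §1 Lemma (3) (chunk p0003 L5–9)]
(Every positive dimension — elliptic curves included: Hodge–Riemann in degree one holds in every dimension,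
`HodgeRiemannDegreeOneAllDimensions`; the unprimed statement below is the case `2 ≤ dim A`.) -/
theorem setOf_forall_mem_divisorLefschetzGroup_comm_eq_adjoin_of_isKaehlerClass' (hA : 0 < A.dim)
    (hQ : IsRationalClass h) {s : ℝ} (hs : s ≠ 0) (hK : IsKaehlerClass A.dim A.X ((s : ℂ) • h)) :
    {T : Module.End ℂ (complexBetti A.X 1) |
        ∀ u ∈ divisorLefschetzGroup A h, ∀ y : complexBetti A.X 1, T (u y) = u (T y)} =
      (Algebra.adjoin ℂ (symmetricPullbackSpan A h : Set (Module.End ℂ (complexBetti A.X 1))) :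
        Set (Module.End ℂ (complexBetti A.X 1))) :=
  Set.ext fun _ ↦ forall_mem_divisorLefschetzGroup_comm_iff_mem_adjoin_of_isKaehlerClass' hA hQ hs hK

/-- **Lemma (3), first clause, as an equality of sets: `End(H¹(A(ℂ); ℂ))^{G_div(X)(ℂ)} = B ⊗ ℂ`**, unconditionally
(`dim A ≥ 2`, `h` a polarization class). [cite: MoonenZarhin1998WeilClasses, §1 Lemma (3) (chunk p0003 L5–9)]
(The case `2 ≤ dim A`, kept for the record; `setOf_forall_mem_divisorLefschetzGroup_comm_eq_adjoin_of_isKaehlerClass'` is every positive dimension.) -/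
theorem setOf_forall_mem_divisorLefschetzGroup_comm_eq_adjoin_of_isKaehlerClass (h2 : 2 ≤ A.dim)
    (hQ : IsRationalClass h) {s : ℝ} (hs : s ≠ 0) (hK : IsKaehlerClass A.dim A.X ((s : ℂ) • h)) :
    {T : Module.End ℂ (complexBetti A.X 1) |
        ∀ u ∈ divisorLefschetzGroup A h, ∀ y : complexBetti A.X 1, T (u y) = u (T y)} =
      (Algebra.adjoin ℂ (symmetricPullbackSpan A h : Set (Module.End ℂ (complexBetti A.X 1))) :
        Set (Module.End ℂ (complexBetti A.X 1))) :=
  setOf_forall_mem_divisorLefschetzGroup_comm_eq_adjoin_of_isKaehlerClass' (lt_of_lt_of_le Nat.zero_lt_two h2) hQ hs hK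

/-- **Moonen–Zarhin 1998, §1 Lemma (1) «the center of `G_div(X)` is the group `U_{K_B}`», `ℂ`-points, UNCONDITIONALLY**
(first form): an element of `G_div(X)(h)(ℂ)` is CENTRAL iff its underlying endomorphism lies in `B ⊗ ℂ` (hence in
`Z(B ⊗ ℂ) = K_B ⊗ ℂ`, as it commutes with `B ⊗ ℂ`). `⇒`: a central element commutes with `G_div(X)(ℂ)`, so lies in
`B ⊗ ℂ` by Lemma (3); `⇐`: `G_div` centralizes `B ⊗ ℂ` (the seat's g13-#6 `mem_center_divisorLefschetzGroup_of_coe_mem_adjoin`).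
[cite: MoonenZarhin1998WeilClasses, §1 Lemma (1) (chunk p0002 L121–124)]
(Every positive dimension — elliptic curves included: Hodge–Riemann in degree one holds in every dimension,
`HodgeRiemannDegreeOneAllDimensions`; the unprimed statement below is the case `2 ≤ dim A`.) -/
theorem mem_center_divisorLefschetzGroup_iff_coe_mem_adjoin_of_isKaehlerClass' (hA : 0 < A.dim)
    (hQ : IsRationalClass h) {s : ℝ} (hs : s ≠ 0) (hK : IsKaehlerClass A.dim A.X ((s : ℂ) • h))
    {z : divisorLefschetzGroup A h} :
    z ∈ Subgroup.center (divisorLefschetzGroup A h) ↔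
      ((z : complexBetti A.X 1 ≃ₗ[ℂ] complexBetti A.X 1) : Module.End ℂ (complexBetti A.X 1)) ∈
        Algebra.adjoin ℂ (symmetricPullbackSpan A h : Set (Module.End ℂ (complexBetti A.X 1))) := by
  refine ⟨fun hz ↦ ?_, mem_center_divisorLefschetzGroup_of_coe_mem_adjoin⟩
  refine (forall_mem_divisorLefschetzGroup_comm_iff_mem_adjoin_of_isKaehlerClass' hA hQ hs hK).1 fun u hu y ↦ ?_
  have e := Subgroup.mem_center_iff.1 hz ⟨u, hu⟩
  have e' := congrArg (fun g : divisorLefschetzGroup A h ↦ ((g : complexBetti A.X 1 ≃ₗ[ℂ] complexBetti A.X 1) y)) e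
  simp only [Subgroup.coe_mul, LinearEquiv.mul_apply] at e'
  rw [LinearEquiv.coe_coe]
  exact e'.symm

/-- **Moonen–Zarhin 1998, §1 Lemma (1) «the center of `G_div(X)` is the group `U_{K_B}`», `ℂ`-points, UNCONDITIONALLY**
(first form): an element of `G_div(X)(h)(ℂ)` is CENTRAL iff its underlying endomorphism lies in `B ⊗ ℂ` (hence in
`Z(B ⊗ ℂ) = K_B ⊗ ℂ`, as it commutes with `B ⊗ ℂ`). `⇒`: a central element commutes with `G_div(X)(ℂ)`, so lies in
`B ⊗ ℂ` by Lemma (3); `⇐`: `G_div` centralizes `B ⊗ ℂ` (the seat's g13-#6 `mem_center_divisorLefschetzGroup_of_coe_mem_adjoin`).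
[cite: MoonenZarhin1998WeilClasses, §1 Lemma (1) (chunk p0002 L121–124)]
(The case `2 ≤ dim A`, kept for the record; `mem_center_divisorLefschetzGroup_iff_coe_mem_adjoin_of_isKaehlerClass'` is every positive dimension.) -/
theorem mem_center_divisorLefschetzGroup_iff_coe_mem_adjoin_of_isKaehlerClass (h2 : 2 ≤ A.dim)
    (hQ : IsRationalClass h) {s : ℝ} (hs : s ≠ 0) (hK : IsKaehlerClass A.dim A.X ((s : ℂ) • h))
    {z : divisorLefschetzGroup A h} :
    z ∈ Subgroup.center (divisorLefschetzGroup A h) ↔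
      ((z : complexBetti A.X 1 ≃ₗ[ℂ] complexBetti A.X 1) : Module.End ℂ (complexBetti A.X 1)) ∈
        Algebra.adjoin ℂ (symmetricPullbackSpan A h : Set (Module.End ℂ (complexBetti A.X 1))) :=
  mem_center_divisorLefschetzGroup_iff_coe_mem_adjoin_of_isKaehlerClass' (lt_of_lt_of_le Nat.zero_lt_two h2) hQ hs hK

/-- **Lemma (1) «`Z(G_div(X)) = U_{K_B}`, `U_{K_B}(R) = {a ∈ (K_B ⊗ R)^* | a a† = 1}`», `ℂ`-points, as the print's set,
UNCONDITIONALLY**: an automorphism `U` of `H¹(A(ℂ); ℂ)` is a central element of `G_div(X)(h)(ℂ)` iff `U` lies in `B ⊗ ℂ`,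
commutes with `B ⊗ ℂ` (i.e. `U ∈ Z(B ⊗ ℂ) = K_B ⊗ ℂ`) and preserves `Q_h` (the condition `a a† = 1`).
[cite: MoonenZarhin1998WeilClasses, §1 Lemma (1) (chunk p0002 L121–124)]
(Every positive dimension — elliptic curves included: Hodge–Riemann in degree one holds in every dimension,
`HodgeRiemannDegreeOneAllDimensions`; the unprimed statement below is the case `2 ≤ dim A`.) -/
theorem mem_divisorLefschetzGroup_and_forall_comm_iff_of_isKaehlerClass' (hA : 0 < A.dim)
    (hQ : IsRationalClass h) {s : ℝ} (hs : s ≠ 0) (hK : IsKaehlerClass A.dim A.X ((s : ℂ) • h))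
    {U : complexBetti A.X 1 ≃ₗ[ℂ] complexBetti A.X 1} :
    (U ∈ divisorLefschetzGroup A h ∧ ∀ g ∈ divisorLefschetzGroup A h, g * U = U * g) ↔
      (U : Module.End ℂ (complexBetti A.X 1)) ∈
          Algebra.adjoin ℂ (symmetricPullbackSpan A h : Set (Module.End ℂ (complexBetti A.X 1))) ∧
        (∀ T ∈ Algebra.adjoin ℂ (symmetricPullbackSpan A h : Set (Module.End ℂ (complexBetti A.X 1))),
          (U : Module.End ℂ (complexBetti A.X 1)) * T = T * U) ∧
        ∀ x y : complexBetti A.X 1, polarizationPairingOne A.X h (A.dim - 1) (U x) (U y) =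
          polarizationPairingOne A.X h (A.dim - 1) x y := by
  constructor
  · rintro ⟨hU, hc⟩
    refine ⟨?_, fun T hT ↦ LinearMap.ext fun x ↦ divisorLefschetzGroup_comm_of_mem_adjoin hU hT x, hU.2⟩
    have hz : (⟨U, hU⟩ : divisorLefschetzGroup A h) ∈ Subgroup.center (divisorLefschetzGroup A h) := by
      rw [Subgroup.mem_center_iff]
      intro g
      exact Subtype.ext (hc g g.2)
    exact (mem_center_divisorLefschetzGroup_iff_coe_mem_adjoin_of_isKaehlerClass' hA hQ hs hK).1 hz
  · rintro ⟨hUB, hUc, hUQ⟩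
    have hU : U ∈ divisorLefschetzGroup A h := by
      refine ⟨fun T hT x ↦ ?_, hUQ⟩
      have e := LinearMap.congr_fun (hUc T (Algebra.subset_adjoin hT)) x
      simpa only [Module.End.mul_apply, LinearEquiv.coe_coe] using e
    refine ⟨hU, fun g hg ↦ ?_⟩
    have hz : (⟨U, hU⟩ : divisorLefschetzGroup A h) ∈ Subgroup.center (divisorLefschetzGroup A h) :=
      mem_center_divisorLefschetzGroup_of_coe_mem_adjoin hUB
    have e := Subgroup.mem_center_iff.1 hz ⟨g, hg⟩
    exact congrArg Subtype.val e

/-- **Lemma (1) «`Z(G_div(X)) = U_{K_B}`, `U_{K_B}(R) = {a ∈ (K_B ⊗ R)^* | a a† = 1}`», `ℂ`-points, as the print's set,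
UNCONDITIONALLY**: an automorphism `U` of `H¹(A(ℂ); ℂ)` is a central element of `G_div(X)(h)(ℂ)` iff `U` lies in `B ⊗ ℂ`,
commutes with `B ⊗ ℂ` (i.e. `U ∈ Z(B ⊗ ℂ) = K_B ⊗ ℂ`) and preserves `Q_h` (the condition `a a† = 1`).
[cite: MoonenZarhin1998WeilClasses, §1 Lemma (1) (chunk p0002 L121–124)]
(The case `2 ≤ dim A`, kept for the record; `mem_divisorLefschetzGroup_and_forall_comm_iff_of_isKaehlerClass'` is every positive dimension.) -/
theorem mem_divisorLefschetzGroup_and_forall_comm_iff_of_isKaehlerClass (h2 : 2 ≤ A.dim)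
    (hQ : IsRationalClass h) {s : ℝ} (hs : s ≠ 0) (hK : IsKaehlerClass A.dim A.X ((s : ℂ) • h))
    {U : complexBetti A.X 1 ≃ₗ[ℂ] complexBetti A.X 1} :
    (U ∈ divisorLefschetzGroup A h ∧ ∀ g ∈ divisorLefschetzGroup A h, g * U = U * g) ↔
      (U : Module.End ℂ (complexBetti A.X 1)) ∈
          Algebra.adjoin ℂ (symmetricPullbackSpan A h : Set (Module.End ℂ (complexBetti A.X 1))) ∧
        (∀ T ∈ Algebra.adjoin ℂ (symmetricPullbackSpan A h : Set (Module.End ℂ (complexBetti A.X 1))),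
          (U : Module.End ℂ (complexBetti A.X 1)) * T = T * U) ∧
        ∀ x y : complexBetti A.X 1, polarizationPairingOne A.X h (A.dim - 1) (U x) (U y) =
          polarizationPairingOne A.X h (A.dim - 1) x y :=
  mem_divisorLefschetzGroup_and_forall_comm_iff_of_isKaehlerClass' (lt_of_lt_of_le Nat.zero_lt_two h2) hQ hs hK

/-- **`G_div(X)(h)(ℂ) = S(A)(h)(ℂ)` iff `B ⊗ ℂ = End⁰(X) ⊗ ℂ`** — the converse of the seat's g13-#6
`divisorLefschetzGroup_eq_unitaryCentralizerGroup_of_forall_mem_adjoin`, now available: if Moonen–Zarhin's group equals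
Milne's, every pull-back `φ^*` commutes with `G_div(X)(ℂ) = S(A)(ℂ)`, hence lies in `B ⊗ ℂ` by Lemma (3). (So the print's
«`B = End⁰(X)`» cases — `m ≥ 2`, types 1 and 2, type 4 with `d ≥ 2` — are exactly the cases `G_div = S`.)
[cite: MoonenZarhin1998WeilClasses, §1 (chunk p0002 L96–97: «if m ≥ 2 or if X is of type 1 or 2, then … Δ = D. If m = 1 then Δ = B») and Lemma (3)]
(Every positive dimension — elliptic curves included: Hodge–Riemann in degree one holds in every dimension,
`HodgeRiemannDegreeOneAllDimensions`; the unprimed statement below is the case `2 ≤ dim A`.) -/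
theorem divisorLefschetzGroup_eq_unitaryCentralizerGroup_iff_forall_mem_adjoin' (hA : 0 < A.dim)
    (hQ : IsRationalClass h) {s : ℝ} (hs : s ≠ 0) (hK : IsKaehlerClass A.dim A.X ((s : ℂ) • h)) :
    divisorLefschetzGroup A h = unitaryCentralizerGroup A h ↔
      ∀ φ : A ⟶ A, pullbackOne A φ ∈
        Algebra.adjoin ℂ (symmetricPullbackSpan A h : Set (Module.End ℂ (complexBetti A.X 1))) := by
  refine ⟨fun hG φ ↦ ?_, divisorLefschetzGroup_eq_unitaryCentralizerGroup_of_forall_mem_adjoin⟩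
  refine (forall_mem_divisorLefschetzGroup_comm_iff_mem_adjoin_of_isKaehlerClass' hA hQ hs hK).1 fun u hu y ↦ ?_
  rw [hG] at hu
  exact (mem_centralizerGroup_iff.1 (mem_unitaryCentralizerGroup_iff.1 hu).1 φ y).symm

/-- **`G_div(X)(h)(ℂ) = S(A)(h)(ℂ)` iff `B ⊗ ℂ = End⁰(X) ⊗ ℂ`** — the converse of the seat's g13-#6
`divisorLefschetzGroup_eq_unitaryCentralizerGroup_of_forall_mem_adjoin`, now available: if Moonen–Zarhin's group equals
Milne's, every pull-back `φ^*` commutes with `G_div(X)(ℂ) = S(A)(ℂ)`, hence lies in `B ⊗ ℂ` by Lemma (3). (So the print's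
«`B = End⁰(X)`» cases — `m ≥ 2`, types 1 and 2, type 4 with `d ≥ 2` — are exactly the cases `G_div = S`.)
[cite: MoonenZarhin1998WeilClasses, §1 (chunk p0002 L96–97: «if m ≥ 2 or if X is of type 1 or 2, then … Δ = D. If m = 1 then Δ = B») and Lemma (3)]
(The case `2 ≤ dim A`, kept for the record; `divisorLefschetzGroup_eq_unitaryCentralizerGroup_iff_forall_mem_adjoin'` is every positive dimension.) -/
theorem divisorLefschetzGroup_eq_unitaryCentralizerGroup_iff_forall_mem_adjoin (h2 : 2 ≤ A.dim)
    (hQ : IsRationalClass h) {s : ℝ} (hs : s ≠ 0) (hK : IsKaehlerClass A.dim A.X ((s : ℂ) • h)) :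
    divisorLefschetzGroup A h = unitaryCentralizerGroup A h ↔
      ∀ φ : A ⟶ A, pullbackOne A φ ∈
        Algebra.adjoin ℂ (symmetricPullbackSpan A h : Set (Module.End ℂ (complexBetti A.X 1))) :=
  divisorLefschetzGroup_eq_unitaryCentralizerGroup_iff_forall_mem_adjoin' (lt_of_lt_of_le Nat.zero_lt_two h2) hQ hs hK

end Main

end Literature.AlgebraicGeometry.HodgeTheory

end
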